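import Literature.AlgebraicGeometry.ComplexMultiplication.CyclotomicFermatCMTypesTwoPowerLevelPrinted
import Literature.AlgebraicGeometry.ComplexMultiplication.CyclotomicFermatCMTypesTwoPowerLevelIsogenies
import HarnessLib

/-!
# Koblitz–Rohrlich THEOREM 4 VERBATIM in the one type `ℤ/2ⁿ` — every `n`, ALL pairs of triples, no g.c.d. hypothesis — and
# THEOREM 4 ON ABELIAN VARIETIES for all admissible triples

Layer `Literature/AlgebraicGeometry/ComplexMultiplication`, namespace `…ComplexMultiplication.CyclotomicFermatCMType`; sequel of
`CyclotomicFermatCMTypesTwoPowerLevelComplete` ∕ `…Classification` ∕ `…Printed` (the §5 Proposition for every `n ≥ 4`; the seven pairs;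
Theorem 4 for every `m` at the product level `2ᵐ·2ᵏ`), of `CyclotomicFermatCMTypesTwoPowerLevelIsogenies` (the complete list at `N = 8`,
kernel-enumerated) and of `CyclotomicFermatCMTypesPrimePowerAllTriples` (descent `p^(k+1) → pᵏ` and lift of permutations ∕ unit relations,
any prime `p`; THEOREM 3 verbatim in `ℤ/3ⁿ`) — the `p = 2` counterpart of the latter's §§5–6.  THEOREMS ONLY (no definition, no named fact,
no `sorry`; kernel `decide` only at `N = 2, 4` and on four closed triples at `N = 8`).

THE SOURCE.  N. Koblitz, D. Rohrlich, *Simple factors in the Jacobian of a Fermat curve*, Canad. J. Math. **30** (1978) 1183–1205,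
THEOREM 4 (p. 1186): "Suppose `N = 2ⁿ`. Then the only isogenies apart from the obvious ones are between pairs of lattices corresponding to
the triples a) `(2ᵐ, 2ⁿ⁻¹ − 2ᵐ⁺¹, 2ⁿ⁻¹ + 2ᵐ)` and `(2ᵐ⁺¹, 2ⁿ⁻² − 2ᵐ, 3(2ⁿ⁻²) − 2ᵐ)` for `0 ≤ m ≤ n − 3`, or b) [as a) in our copy], or
c) `(2ᵐ, 2ᵐ, 2ⁿ − 2ᵐ⁺¹)` and `(2ᵐ⁺¹, 2ⁿ⁻¹ − 2ᵐ, 2ⁿ⁻¹ − 2ᵐ)` for `0 ≤ m ≤ n − 2`, or d) `(2ᵐ, 3(2ᵐ), 2ⁿ − 2ᵐ⁺²)` and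
`(2ⁿ⁻¹ − 2ᵐ, 2ⁿ⁻¹ − 2ᵐ⁺¹, 3(2ᵐ))` for `0 ≤ m ≤ n − 4`, or e) `(2ᵐ, 2ⁿ⁻¹, 2ⁿ⁻¹ − 2ᵐ)` and `(2ᵐ, 2ᵐ, 2ⁿ − 2ᵐ⁺¹)` for `0 ≤ m ≤ n − 2`.
Furthermore, a lattice of type a)ₘ is isogenous to the product of two lattices of type e)ₘ₊₁."; §1 (p. 1185): "`{r, s, t} ~ {r′, s′, t′}`
if and only if there exists `h ∈ (ℤ/Nℤ)*` such that, up to a permutation, we have `{r′, s′, t′} = {⟨hr⟩, ⟨hs⟩, ⟨ht⟩}` … The equality of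
lattices `L_{r,s,t}` resulting from an equivalence of triples will be called an obvious equality, or obvious isogeny."; §1 (p. 1184):
"`N/M = g.c.d.(N, r, s)` … suppose `L_{r,s}` and `L_{r′,s′}` are isogenous. Then … `hH_{r,s} = H_{r′,s′}` for some `h`".

## What is proved (entries of Theorem 4's triples as natural numbers cast into `ℤ/2ⁿ`)

* §1 (private plumbing): transport along `ℤ/N = ℤ/N′`; the entries at level `2ᵏ`, `k ≥ 3`, as naturals; the arithmetic `2ᵐ·(entry at
  level 2ᵏ) = entry at level 2ᵐ⁺ᵏ`.
* §2 `twoPow_triples_zero_eq` (Theorem 4's triples at `m = 0` are the §5 Proposition's: `(2ⁿ − 2², 2⁰, 3·2⁰) = (N − 4, 1, 3)`, …, `n ≥ 3`);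
  **`fermatCMType_twoPow_pairs_eq` — the seven pairs have equal `H` for every `n` and every `m` with `m + 3 ≤ n`, in `ℤ/2ⁿ`**: d)ₘ
  `H_{(N₁−2ᵐ⁺¹, N₁−2ᵐ, 3(2ᵐ))} = H_{(N−2ᵐ⁺², 2ᵐ, 3(2ᵐ))}`, e)ₘ `H_{(N₁, 2ᵐ, N₁−2ᵐ)} = H_{(N−2ᵐ⁺¹, 2ᵐ, 2ᵐ)}`, c)ₘ `H_{(2ᵐ⁺¹, N₁−2ᵐ, N₁−2ᵐ)} =
  H_{(N−2ᵐ⁺¹, 2ᵐ, 2ᵐ)}`, "Furthermore" `H_{(N−2ᵐ⁺², 2ᵐ⁺¹, 2ᵐ⁺¹)} = H_{(N₁−2ᵐ⁺¹, 2ᵐ, N₁+2ᵐ)}`, a)ₘ `H_{(2ᵐ⁺¹, N₂−2ᵐ, 3N₂−2ᵐ)} =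
  H_{(N₁−2ᵐ⁺¹, 2ᵐ, N₁+2ᵐ)}`, `H_{(N₁, 2ᵐ⁺¹, N₁−2ᵐ⁺¹)} = H_{(N₁−2ᵐ⁺¹, 2ᵐ, N₁+2ᵐ)}`, `H_{(N−2ᵐ⁺², 2ᵐ⁺¹, 2ᵐ⁺¹)} = H_{(2ᵐ⁺¹, N₂−2ᵐ, 3N₂−2ᵐ)}`
  (`N = 2ⁿ`, `N₁ = 2ⁿ⁻¹`, `N₂ = 2ⁿ⁻²`; the sibling's seven equalities at level `2ⁿ⁻ᵐ` pulled back and read in `ℤ/2ⁿ`).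
* §3 **`obvious_or_exceptional_of_fermatCMType_eq_twoPow_all` — THEOREM 4 VERBATIM**: for ANY triples `τ = (r,s,t)`, `τ′ = (r′,s′,t′)` of
  non-zero residues modulo `2ⁿ` (`n ≥ 1`) with `r + s + t = 0 = r′ + s′ + t′`: `H_{τ′} = H_τ` ⟹ `{τ′} = {uτ}` for a unit `u` (obvious) OR
  for some `m` with `m + 3 ≤ n` and a unit `w` the pair `(wτ, wτ′)` is one of the seven pairs of `2`-content `2ᵐ` up to order and
  exchange.  Induction on `n`: a unit among the six entries ⟹ the §5 Proposition (`n ≥ 4`, sibling), the complete list at `N = 8` (sibling,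
  kernel), "everything is obvious" at `N = 4`, nothing admissible at `N = 2`; otherwise all six are even, the coincidence descends to
  `2ⁿ⁻¹` (sibling `fermatCMType_eq_of_fermatCMType_level_mul_eq`) and the answer lifts with `m ↦ m + 1` (sibling
  `exists_unit_multiset_mul_eq_succ`).  The `2`-content is found by the induction; pairs of DIFFERENT `2`-content are included (they occur:
  `(N₁−2, 1, N₁+1) ~ (N−4, 2, 2)`).
* §4 **THEOREM 4 ON ABELIAN VARIETIES, ALL PAIRS OF ADMISSIBLE TRIPLES** `isIsogenous_iff_obvious_or_exceptional_twoPow_all`: abelian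
  varieties `A`, `A′` of types `Φ_{H_τ}`, `Φ_{H_{τ′}}` of `ℚ(ζ_{2ⁿ})` are ISOGENOUS iff `{τ′} = {uτ}` for a unit `u` ("the obvious ones") or,
  for some `m` (`m + 3 ≤ n`) and units `w, w′`, `(wτ, w′τ′)` is one of the seven pairs of content `2ᵐ` up to order and exchange
  (Shimura–Taniyama `A_τ ∼ A_{τ′} ⟺ H_{τ′} = H_{uτ}`, sibling `isIsogenous_fermatCMType_iff_exists_eq_mul`; "⟸" by §2).

## Honest column / NOT here

* K–R compare lattices at their own levels `M = N/`g.c.d.; the tree reads every `H_τ` at the full level `2ⁿ`, where triples of `2`-content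
  `2ᵐ` define pull-backs of level-`2ⁿ⁻ᵐ` sets ("`N/M = g.c.d.(N, r, s)`").  In this reading the g.c.d.-free statement is meaningful and is
  a COROLLARY of the printed Theorem 4 ∕ §5 Proposition by the change of level — cites locate §1's bookkeeping and Theorem 4, not a printed
  g.c.d.-free claim.
* The first branch is K–R's "obvious" equivalence (unit multiple + permutation), which does NOT preserve `H` (`H_{uτ} = u⁻¹H_τ`): so §3 has
  no converse at the level of `H` — the equivalence lives on abelian varieties (§4).  For `2`-content `≤ 2ⁿ⁻⁴` the siblings give the sharper
  first branch "`{τ′} = {τ}`" (`perm_or_exceptional_of_fermatCMType_eq_twoPow`, `…_twoPow_mul`); at content `2ⁿ⁻³` (level `8`) the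
  sibling's list is phrased with unit multiples, whence the uniform "obvious" here.
* SEVEN pairs per `m` (the §5 Proposition prints TEN; siblings' honest columns): c)ₘ and a)ₘ consist of unit multiples of each other (K–R
  list them nevertheless), and at `m = n − 3` several of the seven coincide or degenerate to permutations — all are genuine coincidences of
  `H` (§2), so the disjunction is as printed, possibly redundant.  Family b) is illegible in our copy; nothing depends on it.
* The residue-set input is the siblings' (parity criterion at `p = 2`, ours — not K–R's omitted argument ∕ Probabilistic Lemma; `N = 8` by the
  sibling's kernel enumeration).  Dimensions `φ(2ⁿ)/2` and non-obviousness of the pairs are in the siblings (`exists_isIsogenous_not_obvious_twoPow`).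

## References

* [KoblitzRohrlich1978] N. Koblitz, D. Rohrlich, Canad. J. Math. 30 (1978) 1183–1205: Theorem 4 (p. 1186), §1 (pp. 1183–1185), §5
  Proposition (p. 1200).
* [Shimura1998] G. Shimura, *Abelian Varieties with Complex Multiplication and Modular Functions*, §8.4 Example (1), §6.1 Corollary
  (through `CyclotomicCMTypeIsogenyClasses` ∕ `CyclotomicFermatCMTypesPrimePowerIsogenies`).

## Provenance

Cell `pub-hodgecm2` (COR-CM), literature seat `lit-deligne-3` gen 38 (claim KR78-THM4-ALLTRIPLES; count-neutral, own lane).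
-/

noncomputable section

open NumberField

namespace Literature.AlgebraicGeometry.ComplexMultiplication

open Literature.NumberTheory.ComplexMultiplication
open Literature.AlgebraicGeometry.Motives (CMType)
open Literature.AlgebraicGeometry.HodgeTheory (fermatCMType)
open Literature.AlgebraicGeometry.Pohlmann1968 Literature.AlgebraicGeometry.Pohlmann1968.Cyclotomic

namespace CyclotomicFermatCMType

/-! ## §1 Plumbing: transport along `ℤ/N = ℤ/N′`; the entries of Theorem 4's triples at `m = 0` and under `m ↦ m + 1` -/

section Plumbing

variable {N N' : ℕ}

/-- The image of a triple under a map (private copy). [folklore] -/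
private theorem map_triple₂ {α β : Type*} (F : α → β) (x y z : α) :
    (({x, y, z} : Multiset α).map F) = {F x, F y, F z} := by
  simp only [Multiset.insert_eq_cons, Multiset.map_cons, Multiset.map_singleton]

/-- Equality of Fermat sets is invariant under `ℤ/N = ℤ/N′` for `N = N′` (private copy of the sibling's plumbing). [folklore] -/
private theorem fermatCMType_ringEquivCongr_eq_iff₂ [NeZero N] [NeZero N'] (h : N = N') (r s t r' s' t' : ZMod N) :
    fermatCMType N' (ZMod.ringEquivCongr h r') (ZMod.ringEquivCongr h s') (ZMod.ringEquivCongr h t') =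
        fermatCMType N' (ZMod.ringEquivCongr h r) (ZMod.ringEquivCongr h s) (ZMod.ringEquivCongr h t) ↔
      fermatCMType N r' s' t' = fermatCMType N r s t := by
  subst h
  simp only [ZMod.ringEquivCongr_refl, RingEquiv.refl_apply]

/-- Equality of Fermat sets with natural-number entries is invariant under `ℤ/N = ℤ/N′` for `N = N′` (private plumbing). [folklore] -/
private theorem fermatCMType_natCast_transport₂ [NeZero N] [NeZero N'] (h : N = N') {a b c a' b' c' : ℕ}
    (H : fermatCMType N (a' : ZMod N) (b' : ZMod N) (c' : ZMod N) = fermatCMType N (a : ZMod N) (b : ZMod N) (c : ZMod N)) :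
    fermatCMType N' (a' : ZMod N') (b' : ZMod N') (c' : ZMod N') = fermatCMType N' (a : ZMod N') (b : ZMod N') (c : ZMod N') := by
  subst h
  exact H

variable {k : ℕ}

/-- The entries of the seven pairs as natural numbers modulo `2ᵏ`, `k ≥ 3` (the sibling's `natCast_exceptional_entries_twoPow` from
`k = 3` on; private). [cite: KoblitzRohrlich1978, §5 (p. 1200)] -/
private theorem entries₃ (hk : 3 ≤ k) :
    (-4 : ZMod (2 ^ k)) = ((2 ^ k - 4 : ℕ) : ZMod (2 ^ k)) ∧ (-2 : ZMod (2 ^ k)) = ((2 ^ k - 2 : ℕ) : ZMod (2 ^ k)) ∧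
      (2 : ZMod (2 ^ k)) ^ (k - 1) = ((2 ^ (k - 1) : ℕ) : ZMod (2 ^ k)) ∧
      (2 : ZMod (2 ^ k)) ^ (k - 1) - 2 = ((2 ^ (k - 1) - 2 : ℕ) : ZMod (2 ^ k)) ∧
      (2 : ZMod (2 ^ k)) ^ (k - 1) - 1 = ((2 ^ (k - 1) - 1 : ℕ) : ZMod (2 ^ k)) ∧
      (2 : ZMod (2 ^ k)) ^ (k - 1) + 1 = ((2 ^ (k - 1) + 1 : ℕ) : ZMod (2 ^ k)) ∧
      (2 : ZMod (2 ^ k)) ^ (k - 2) - 1 = ((2 ^ (k - 2) - 1 : ℕ) : ZMod (2 ^ k)) ∧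
      3 * (2 : ZMod (2 ^ k)) ^ (k - 2) - 1 = ((3 * 2 ^ (k - 2) - 1 : ℕ) : ZMod (2 ^ k)) ∧
      (1 : ZMod (2 ^ k)) = ((1 : ℕ) : ZMod (2 ^ k)) ∧ (2 : ZMod (2 ^ k)) = ((2 : ℕ) : ZMod (2 ^ k)) ∧
      (3 : ZMod (2 ^ k)) = ((3 : ℕ) : ZMod (2 ^ k)) := by
  have h2 : 2 ≤ 2 ^ (k - 2) := by
    calc (2 : ℕ) = 2 ^ 1 := by norm_num
      _ ≤ 2 ^ (k - 2) := Nat.pow_le_pow_right (by norm_num) (by omega)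
  have hk1 : 2 ^ (k - 1) = 2 * 2 ^ (k - 2) := by
    rw [← pow_succ']
    congr 1
    omega
  have hk0 : 2 ^ k = 2 * 2 ^ (k - 1) := by
    rw [← pow_succ']
    congr 1
    omega
  refine ⟨?_, ?_, ?_, ?_, ?_, ?_, ?_, ?_, by norm_num, by norm_num, by norm_num⟩
  · rw [Nat.cast_sub (by omega), ZMod.natCast_self, zero_sub, Nat.cast_ofNat]
  · rw [Nat.cast_sub (by omega), ZMod.natCast_self, zero_sub, Nat.cast_ofNat]
  · push_cast; ring
  · push_cast [Nat.cast_sub (show 2 ≤ 2 ^ (k - 1) by omega)]; ring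
  · push_cast [Nat.cast_sub (show 1 ≤ 2 ^ (k - 1) by omega)]; ring
  · push_cast; ring
  · push_cast [Nat.cast_sub (show 1 ≤ 2 ^ (k - 2) by omega)]; ring
  · push_cast [Nat.cast_sub (show 1 ≤ 3 * 2 ^ (k - 2) by omega)]; ring

/-- The arithmetic `2ᵐ·(entry at level 2ᵏ) = entry at level 2ᵐ⁺ᵏ`, `k ≥ 3` (the sibling's `twoPow_theoremFour_arith` from `k = 3` on;
private). [cite: KoblitzRohrlich1978, Theorem 4 (p. 1186)] -/
private theorem arith₃ (hk : 3 ≤ k) (m : ℕ) :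
    2 ^ m * (2 ^ k - 4) = 2 ^ (m + k) - 2 ^ (m + 2) ∧ 2 ^ m * 1 = 2 ^ m ∧ 2 ^ m * 3 = 3 * 2 ^ m ∧
      2 ^ m * (2 ^ (k - 1) - 2) = 2 ^ (m + k - 1) - 2 ^ (m + 1) ∧ 2 ^ m * (2 ^ (k - 1) - 1) = 2 ^ (m + k - 1) - 2 ^ m ∧
      2 ^ m * (2 ^ k - 2) = 2 ^ (m + k) - 2 ^ (m + 1) ∧ 2 ^ m * 2 ^ (k - 1) = 2 ^ (m + k - 1) ∧ 2 ^ m * 2 = 2 ^ (m + 1) ∧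
      2 ^ m * (2 ^ (k - 1) + 1) = 2 ^ (m + k - 1) + 2 ^ m ∧ 2 ^ m * (2 ^ (k - 2) - 1) = 2 ^ (m + k - 2) - 2 ^ m ∧
      2 ^ m * (3 * 2 ^ (k - 2) - 1) = 3 * 2 ^ (m + k - 2) - 2 ^ m := by
  have h1 : 2 ^ (m + k - 1) = 2 ^ m * 2 ^ (k - 1) := by
    rw [← pow_add]
    congr 1
    omega
  have h2 : 2 ^ (m + k - 2) = 2 ^ m * 2 ^ (k - 2) := by
    rw [← pow_add]
    congr 1
    omega
  have h4 : 2 ^ (m + 2) = 2 ^ m * 4 := by rw [pow_add]; norm_num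
  have h3 : 2 ^ (m + 1) = 2 ^ m * 2 := pow_succ 2 m
  refine ⟨?_, mul_one _, mul_comm _ _, ?_, ?_, ?_, h1.symm, (pow_succ 2 m).symm, ?_, ?_, ?_⟩
  · rw [pow_add, h4, Nat.mul_sub]
  · rw [h1, h3, Nat.mul_sub]
  · rw [h1, Nat.mul_sub, mul_one]
  · rw [pow_add, h3, Nat.mul_sub]
  · rw [h1, mul_add, mul_one]
  · rw [h2, Nat.mul_sub, mul_one]
  · rw [h2, Nat.mul_sub, mul_one, mul_left_comm]

end Plumbing

/-! ## §2 Theorem 4's triples in the one type `ℤ/2ⁿ`: the `m = 0` dictionary and the seven coincidences for every `m` (`m + 3 ≤ n`) -/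

section Pairs

variable {n m : ℕ}

/-- **Theorem 4's triples at `m = 0` are the §5 Proposition's**: `(2ⁿ − 2², 2⁰, 3·2⁰) = (N − 4, 1, 3)`, `(2ⁿ⁻¹ − 2¹, 2ⁿ⁻¹ − 2⁰, 3·2⁰) =
(N₁ − 2, N₁ − 1, 3)`, `(2ⁿ − 2¹, 2⁰, 2⁰) = (N − 2, 1, 1)`, `(2ⁿ⁻¹, 2⁰, 2ⁿ⁻¹ − 2⁰) = (N₁, 1, N₁ − 1)`, `(2¹, 2ⁿ⁻¹ − 2⁰, 2ⁿ⁻¹ − 2⁰) =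
(2, N₁ − 1, N₁ − 1)`, `(2ⁿ⁻¹ − 2¹, 2⁰, 2ⁿ⁻¹ + 2⁰) = (N₁ − 2, 1, N₁ + 1)`, `(2ⁿ − 2², 2¹, 2¹) = (N − 4, 2, 2)`, `(2ⁿ⁻¹, 2¹, 2ⁿ⁻¹ − 2¹) =
(N₁, 2, N₁ − 2)`, `(2¹, 2ⁿ⁻² − 2⁰, 3·2ⁿ⁻² − 2⁰) = (2, N₂ − 1, 3N₂ − 1)` as residues modulo `2ⁿ` (`n ≥ 3`).
[cite: KoblitzRohrlich1978, Theorem 4 (p. 1186) and §5 Proposition (p. 1200)] -/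
theorem twoPow_triples_zero_eq (hn : 3 ≤ n) :
    (({((2 ^ n - 2 ^ (0 + 2) : ℕ) : ZMod (2 ^ n)), ((2 ^ 0 : ℕ) : ZMod (2 ^ n)),
        ((3 * 2 ^ 0 : ℕ) : ZMod (2 ^ n))} : Multiset (ZMod (2 ^ n))) = {-4, 1, 3}) ∧
    (({((2 ^ (n - 1) - 2 ^ (0 + 1) : ℕ) : ZMod (2 ^ n)), ((2 ^ (n - 1) - 2 ^ 0 : ℕ) : ZMod (2 ^ n)),
        ((3 * 2 ^ 0 : ℕ) : ZMod (2 ^ n))} : Multiset (ZMod (2 ^ n))) = {(2 : ZMod (2 ^ n)) ^ (n - 1) - 2, (2 : ZMod (2 ^ n)) ^ (n - 1) - 1, 3}) ∧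
    (({((2 ^ n - 2 ^ (0 + 1) : ℕ) : ZMod (2 ^ n)), ((2 ^ 0 : ℕ) : ZMod (2 ^ n)),
        ((2 ^ 0 : ℕ) : ZMod (2 ^ n))} : Multiset (ZMod (2 ^ n))) = {-2, 1, 1}) ∧
    (({((2 ^ (n - 1) : ℕ) : ZMod (2 ^ n)), ((2 ^ 0 : ℕ) : ZMod (2 ^ n)),
        ((2 ^ (n - 1) - 2 ^ 0 : ℕ) : ZMod (2 ^ n))} : Multiset (ZMod (2 ^ n))) = {(2 : ZMod (2 ^ n)) ^ (n - 1), 1, (2 : ZMod (2 ^ n)) ^ (n - 1) - 1}) ∧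
    (({((2 ^ (0 + 1) : ℕ) : ZMod (2 ^ n)), ((2 ^ (n - 1) - 2 ^ 0 : ℕ) : ZMod (2 ^ n)),
        ((2 ^ (n - 1) - 2 ^ 0 : ℕ) : ZMod (2 ^ n))} : Multiset (ZMod (2 ^ n))) = {2, (2 : ZMod (2 ^ n)) ^ (n - 1) - 1, (2 : ZMod (2 ^ n)) ^ (n - 1) - 1}) ∧
    (({((2 ^ (n - 1) - 2 ^ (0 + 1) : ℕ) : ZMod (2 ^ n)), ((2 ^ 0 : ℕ) : ZMod (2 ^ n)),
        ((2 ^ (n - 1) + 2 ^ 0 : ℕ) : ZMod (2 ^ n))} : Multiset (ZMod (2 ^ n))) = {(2 : ZMod (2 ^ n)) ^ (n - 1) - 2, 1, (2 : ZMod (2 ^ n)) ^ (n - 1) + 1}) ∧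
    (({((2 ^ n - 2 ^ (0 + 2) : ℕ) : ZMod (2 ^ n)), ((2 ^ (0 + 1) : ℕ) : ZMod (2 ^ n)),
        ((2 ^ (0 + 1) : ℕ) : ZMod (2 ^ n))} : Multiset (ZMod (2 ^ n))) = {-4, 2, 2}) ∧
    (({((2 ^ (n - 1) : ℕ) : ZMod (2 ^ n)), ((2 ^ (0 + 1) : ℕ) : ZMod (2 ^ n)),
        ((2 ^ (n - 1) - 2 ^ (0 + 1) : ℕ) : ZMod (2 ^ n))} : Multiset (ZMod (2 ^ n))) = {(2 : ZMod (2 ^ n)) ^ (n - 1), 2, (2 : ZMod (2 ^ n)) ^ (n - 1) - 2}) ∧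
    (({((2 ^ (0 + 1) : ℕ) : ZMod (2 ^ n)), ((2 ^ (n - 2) - 2 ^ 0 : ℕ) : ZMod (2 ^ n)),
        ((3 * 2 ^ (n - 2) - 2 ^ 0 : ℕ) : ZMod (2 ^ n))} : Multiset (ZMod (2 ^ n))) = {2, (2 : ZMod (2 ^ n)) ^ (n - 2) - 1, 3 * (2 : ZMod (2 ^ n)) ^ (n - 2) - 1}) := by
  obtain ⟨eM4, eM2, eP1, eP1m2, eP1m1, eP1p1, eP2m1, eP2x3m1, -, -, -⟩ := entries₃ hn
  have z1 : ((2 ^ n - 2 ^ (0 + 2) : ℕ) : ZMod (2 ^ n)) = -4 := by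
    rw [show (2 : ℕ) ^ (0 + 2) = 4 by norm_num]; exact eM4.symm
  have z2 : ((2 ^ 0 : ℕ) : ZMod (2 ^ n)) = 1 := by norm_num
  have z3 : ((3 * 2 ^ 0 : ℕ) : ZMod (2 ^ n)) = 3 := by norm_num
  have z4 : ((2 ^ (n - 1) - 2 ^ (0 + 1) : ℕ) : ZMod (2 ^ n)) = (2 : ZMod (2 ^ n)) ^ (n - 1) - 2 := by
    rw [show (2 : ℕ) ^ (0 + 1) = 2 by norm_num]; exact eP1m2.symm
  have z5 : ((2 ^ (n - 1) - 2 ^ 0 : ℕ) : ZMod (2 ^ n)) = (2 : ZMod (2 ^ n)) ^ (n - 1) - 1 := by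
    rw [pow_zero]; exact eP1m1.symm
  have z6 : ((2 ^ n - 2 ^ (0 + 1) : ℕ) : ZMod (2 ^ n)) = -2 := by
    rw [show (2 : ℕ) ^ (0 + 1) = 2 by norm_num]; exact eM2.symm
  have z7 : ((2 ^ (n - 1) : ℕ) : ZMod (2 ^ n)) = (2 : ZMod (2 ^ n)) ^ (n - 1) := eP1.symm
  have z8 : ((2 ^ (0 + 1) : ℕ) : ZMod (2 ^ n)) = 2 := by norm_num
  have z9 : ((2 ^ (n - 1) + 2 ^ 0 : ℕ) : ZMod (2 ^ n)) = (2 : ZMod (2 ^ n)) ^ (n - 1) + 1 := by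
    rw [pow_zero]; exact eP1p1.symm
  have z10 : ((2 ^ (n - 2) - 2 ^ 0 : ℕ) : ZMod (2 ^ n)) = (2 : ZMod (2 ^ n)) ^ (n - 2) - 1 := by
    rw [pow_zero]; exact eP2m1.symm
  have z11 : ((3 * 2 ^ (n - 2) - 2 ^ 0 : ℕ) : ZMod (2 ^ n)) = 3 * (2 : ZMod (2 ^ n)) ^ (n - 2) - 1 := by
    rw [pow_zero]; exact eP2x3m1.symm
  refine ⟨?_, ?_, ?_, ?_, ?_, ?_, ?_, ?_, ?_⟩
  · rw [z1, z2, z3]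
  · rw [z4, z5, z3]
  · rw [z6, z2]
  · rw [z7, z2, z5]
  · rw [z8, z5]
  · rw [z4, z2, z9]
  · rw [z1, z8]
  · rw [z7, z8, z4]
  · rw [z8, z10, z11]

/-- **THEOREM 4's PAIRS HAVE EQUAL `H` FOR EVERY `n` AND EVERY `m` WITH `m + 3 ≤ n`, in the one type `ℤ/2ⁿ`** (entries as natural
numbers; with `N = 2ⁿ`, `N₁ = 2ⁿ⁻¹`, `N₂ = 2ⁿ⁻²`): d)ₘ `H_{(N₁ − 2ᵐ⁺¹, N₁ − 2ᵐ, 3(2ᵐ))} = H_{(N − 2ᵐ⁺², 2ᵐ, 3(2ᵐ))}`; e)ₘ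
`H_{(N₁, 2ᵐ, N₁ − 2ᵐ)} = H_{(N − 2ᵐ⁺¹, 2ᵐ, 2ᵐ)}`; c)ₘ `H_{(2ᵐ⁺¹, N₁ − 2ᵐ, N₁ − 2ᵐ)} = H_{(N − 2ᵐ⁺¹, 2ᵐ, 2ᵐ)}`; "Furthermore"
`H_{(N − 2ᵐ⁺², 2ᵐ⁺¹, 2ᵐ⁺¹)} = H_{(N₁ − 2ᵐ⁺¹, 2ᵐ, N₁ + 2ᵐ)}`; a)ₘ `H_{(2ᵐ⁺¹, N₂ − 2ᵐ, 3N₂ − 2ᵐ)} = H_{(N₁ − 2ᵐ⁺¹, 2ᵐ, N₁ + 2ᵐ)}`;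
`H_{(N₁, 2ᵐ⁺¹, N₁ − 2ᵐ⁺¹)} = H_{(N₁ − 2ᵐ⁺¹, 2ᵐ, N₁ + 2ᵐ)}`; `H_{(N − 2ᵐ⁺², 2ᵐ⁺¹, 2ᵐ⁺¹)} = H_{(2ᵐ⁺¹, N₂ − 2ᵐ, 3N₂ − 2ᵐ)}` — the sibling
`…Classification`'s seven equalities at level `2ⁿ⁻ᵐ` pulled back along `ℤ/2ⁿ → ℤ/2ⁿ⁻ᵐ` (`fermatCMType_level_mul_eq_of_eq`) and read in
`ℤ/2ⁿ` (the siblings `…Coincidences` ∕ `…Furthermore` have e)ₘ, d)ₘ and the "Furthermore" pairs at the product level `2ᵐ·2ⁿ⁻ᵐ`).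
[cite: KoblitzRohrlich1978, Theorem 4 (p. 1186), §5 Proposition (p. 1200), §1 (pp. 1183–1184)] -/
theorem fermatCMType_twoPow_pairs_eq (hm : m + 3 ≤ n) :
    fermatCMType (2 ^ n) ((2 ^ (n - 1) - 2 ^ (m + 1) : ℕ) : ZMod (2 ^ n)) ((2 ^ (n - 1) - 2 ^ m : ℕ) : ZMod (2 ^ n))
        ((3 * 2 ^ m : ℕ) : ZMod (2 ^ n)) =
      fermatCMType (2 ^ n) ((2 ^ n - 2 ^ (m + 2) : ℕ) : ZMod (2 ^ n)) ((2 ^ m : ℕ) : ZMod (2 ^ n))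
        ((3 * 2 ^ m : ℕ) : ZMod (2 ^ n)) ∧
      fermatCMType (2 ^ n) ((2 ^ (n - 1) : ℕ) : ZMod (2 ^ n)) ((2 ^ m : ℕ) : ZMod (2 ^ n))
        ((2 ^ (n - 1) - 2 ^ m : ℕ) : ZMod (2 ^ n)) =
      fermatCMType (2 ^ n) ((2 ^ n - 2 ^ (m + 1) : ℕ) : ZMod (2 ^ n)) ((2 ^ m : ℕ) : ZMod (2 ^ n))
        ((2 ^ m : ℕ) : ZMod (2 ^ n)) ∧
      fermatCMType (2 ^ n) ((2 ^ (m + 1) : ℕ) : ZMod (2 ^ n)) ((2 ^ (n - 1) - 2 ^ m : ℕ) : ZMod (2 ^ n))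
        ((2 ^ (n - 1) - 2 ^ m : ℕ) : ZMod (2 ^ n)) =
      fermatCMType (2 ^ n) ((2 ^ n - 2 ^ (m + 1) : ℕ) : ZMod (2 ^ n)) ((2 ^ m : ℕ) : ZMod (2 ^ n))
        ((2 ^ m : ℕ) : ZMod (2 ^ n)) ∧
      fermatCMType (2 ^ n) ((2 ^ n - 2 ^ (m + 2) : ℕ) : ZMod (2 ^ n)) ((2 ^ (m + 1) : ℕ) : ZMod (2 ^ n))
        ((2 ^ (m + 1) : ℕ) : ZMod (2 ^ n)) =
      fermatCMType (2 ^ n) ((2 ^ (n - 1) - 2 ^ (m + 1) : ℕ) : ZMod (2 ^ n)) ((2 ^ m : ℕ) : ZMod (2 ^ n))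
        ((2 ^ (n - 1) + 2 ^ m : ℕ) : ZMod (2 ^ n)) ∧
      fermatCMType (2 ^ n) ((2 ^ (m + 1) : ℕ) : ZMod (2 ^ n)) ((2 ^ (n - 2) - 2 ^ m : ℕ) : ZMod (2 ^ n))
        ((3 * 2 ^ (n - 2) - 2 ^ m : ℕ) : ZMod (2 ^ n)) =
      fermatCMType (2 ^ n) ((2 ^ (n - 1) - 2 ^ (m + 1) : ℕ) : ZMod (2 ^ n)) ((2 ^ m : ℕ) : ZMod (2 ^ n))
        ((2 ^ (n - 1) + 2 ^ m : ℕ) : ZMod (2 ^ n)) ∧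
      fermatCMType (2 ^ n) ((2 ^ (n - 1) : ℕ) : ZMod (2 ^ n)) ((2 ^ (m + 1) : ℕ) : ZMod (2 ^ n))
        ((2 ^ (n - 1) - 2 ^ (m + 1) : ℕ) : ZMod (2 ^ n)) =
      fermatCMType (2 ^ n) ((2 ^ (n - 1) - 2 ^ (m + 1) : ℕ) : ZMod (2 ^ n)) ((2 ^ m : ℕ) : ZMod (2 ^ n))
        ((2 ^ (n - 1) + 2 ^ m : ℕ) : ZMod (2 ^ n)) ∧
      fermatCMType (2 ^ n) ((2 ^ n - 2 ^ (m + 2) : ℕ) : ZMod (2 ^ n)) ((2 ^ (m + 1) : ℕ) : ZMod (2 ^ n))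
        ((2 ^ (m + 1) : ℕ) : ZMod (2 ^ n)) =
      fermatCMType (2 ^ n) ((2 ^ (m + 1) : ℕ) : ZMod (2 ^ n)) ((2 ^ (n - 2) - 2 ^ m : ℕ) : ZMod (2 ^ n))
        ((3 * 2 ^ (n - 2) - 2 ^ m : ℕ) : ZMod (2 ^ n)) := by
  obtain ⟨k, rfl⟩ : ∃ k, n = m + k := ⟨n - m, by omega⟩
  have hk : 3 ≤ k := by omega
  haveI : NeZero (2 ^ k) := ⟨pow_ne_zero _ two_ne_zero⟩
  haveI : NeZero (2 ^ m * 2 ^ k) := ⟨mul_ne_zero (pow_ne_zero _ two_ne_zero) (pow_ne_zero _ two_ne_zero)⟩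
  have hd : 0 < 2 ^ m := pow_pos (by norm_num) m
  have hN : 2 ^ m * 2 ^ k = 2 ^ (m + k) := (pow_add 2 m k).symm
  have P := fermatCMType_eq_of_exceptional_pairs_twoPow (n := k) hk
  obtain ⟨eM4, eM2, eP1, eP1m2, eP1m1, eP1p1, eP2m1, eP2x3m1, eOne, eTwo, eThree⟩ := entries₃ hk
  rw [eP2x3m1, eP2m1, eP1m2, eP1m1, eP1p1, eP1, eM4, eM2, eThree, eTwo, eOne] at P
  obtain ⟨P₁, P₂, P₃, P₄, P₅, P₆, P₇⟩ := P
  obtain ⟨a1, a2, a3, a4, a5, a6, a7, a8, a9, a10, a11⟩ := arith₃ hk m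
  refine ⟨?_, ?_, ?_, ?_, ?_, ?_, ?_⟩
  · have Q := fermatCMType_natCast_transport₂ hN (fermatCMType_level_mul_eq_of_eq (M := 2 ^ k) hd P₁)
    rw [a4, a5, a3, a1, a2] at Q
    exact Q
  · have Q := fermatCMType_natCast_transport₂ hN (fermatCMType_level_mul_eq_of_eq (M := 2 ^ k) hd P₂)
    rw [a7, a2, a5, a6] at Q
    exact Q
  · have Q := fermatCMType_natCast_transport₂ hN (fermatCMType_level_mul_eq_of_eq (M := 2 ^ k) hd P₃)
    rw [a8, a5, a6, a2] at Q
    exact Q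
  · have Q := fermatCMType_natCast_transport₂ hN (fermatCMType_level_mul_eq_of_eq (M := 2 ^ k) hd P₄)
    rw [a1, a8, a4, a2, a9] at Q
    exact Q
  · have Q := fermatCMType_natCast_transport₂ hN (fermatCMType_level_mul_eq_of_eq (M := 2 ^ k) hd P₅)
    rw [a8, a10, a11, a4, a2, a9] at Q
    exact Q
  · have Q := fermatCMType_natCast_transport₂ hN (fermatCMType_level_mul_eq_of_eq (M := 2 ^ k) hd P₆)
    rw [a7, a8, a4, a2, a9] at Q
    exact Q
  · have Q := fermatCMType_natCast_transport₂ hN (fermatCMType_level_mul_eq_of_eq (M := 2 ^ k) hd P₇)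
    rw [a1, a8, a10, a11] at Q
    exact Q

end Pairs

/-! ## §3 THEOREM 4 VERBATIM in the one type `ℤ/2ⁿ`: every `n`, all pairs of admissible triples -/

section AllTriples

/-- Modulo `2` there is no admissible triple (`1 + 1 + 1 ≠ 0`): the level below `m = n − 1` is empty. [cite: KoblitzRohrlich1978, §5 (p. 1200, "at least one component in a triple must be even")] -/
private theorem no_triple_two {n : ℕ} (hn : n = 1) {r s t : ZMod (2 ^ n)} (hr : r ≠ 0) (hs : s ≠ 0) (ht : t ≠ 0)
    (hrst : r + s + t = 0) : False := by
  subst hn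
  have key : ∀ a b c : ZMod (2 ^ 1), a ≠ 0 → b ≠ 0 → c ≠ 0 → a + b + c ≠ 0 := by decide
  exact key r s t hr hs ht hrst

/-- Modulo `4` every admissible triple is a permutation of `(2, 1, 1)` or of `(2, 3, 3) = 3·(2, 1, 1)`: any two are "obviously"
equivalent (Theorem 4's members with `m = n − 2` are trivial). [cite: KoblitzRohrlich1978, Theorem 4 c), e) (p. 1186) and §1 (p. 1185, "obvious")] -/
private theorem obvious_four {n : ℕ} (hn : n = 2) {r s t r' s' t' : ZMod (2 ^ n)} (hr0 : r ≠ 0) (hs0 : s ≠ 0) (ht0 : t ≠ 0)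
    (hrst : r + s + t = 0) (hr'0 : r' ≠ 0) (hs'0 : s' ≠ 0) (ht'0 : t' ≠ 0) (hrst' : r' + s' + t' = 0) :
    ∃ u : ZMod (2 ^ n), IsUnit u ∧ ({r', s', t'} : Multiset (ZMod (2 ^ n))) = {u * r, u * s, u * t} := by
  subst hn
  have key : ∀ a b c : ZMod (2 ^ 2), a ≠ 0 → b ≠ 0 → c ≠ 0 → a + b + c = 0 →
      ({a, b, c} : Multiset (ZMod (2 ^ 2))) = {2, 1, 1} ∨ ({a, b, c} : Multiset (ZMod (2 ^ 2))) = {2, 3, 3} := by decide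
  have h3 : IsUnit (3 : ZMod (2 ^ 2)) := IsUnit.of_mul_eq_one (3 : ZMod (2 ^ 2)) (by decide)
  have e1 : (({2, 1, 1} : Multiset (ZMod (2 ^ 2))).map fun v => (3 : ZMod (2 ^ 2)) * v) = {2, 3, 3} := by decide
  have e2 : (({2, 3, 3} : Multiset (ZMod (2 ^ 2))).map fun v => (3 : ZMod (2 ^ 2)) * v) = {2, 1, 1} := by decide
  have hm : ∀ u : ZMod (2 ^ 2), ({u * r, u * s, u * t} : Multiset (ZMod (2 ^ 2))) = ({r, s, t} : Multiset (ZMod (2 ^ 2))).map fun v => u * v :=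
    fun u => (map_triple₂ _ r s t).symm
  rcases key r s t hr0 hs0 ht0 hrst with h | h <;> rcases key r' s' t' hr'0 hs'0 ht'0 hrst' with h' | h'
  · exact ⟨1, isUnit_one, by rw [one_mul, one_mul, one_mul, h, h']⟩
  · exact ⟨3, h3, by rw [hm, h, e1, h']⟩
  · exact ⟨3, h3, by rw [hm, h, e2, h']⟩
  · exact ⟨1, isUnit_one, by rw [one_mul, one_mul, one_mul, h, h']⟩

/-- **Modulo `8`** (the sibling `…TwoPowerLevelIsogenies`' complete list at `N = 8`, kernel-enumerated there, read in the present format):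
two admissible triples with an odd entry and `H_{τ′} = H_τ` are obviously equivalent, or for a unit `w` the pair `(wτ, wτ′)` is Theorem 4's
e)₀ `((6,1,1), (4,1,3))` or the "Furthermore" pair `((2,1,5), (4,2,2))` up to order. [cite: KoblitzRohrlich1978, Theorem 4 (p. 1186)] -/
private theorem base_eight {n : ℕ} (hn : n = 3) {r s t r' s' t' : ZMod (2 ^ n)}
    (hr0 : r ≠ 0) (hs0 : s ≠ 0) (ht0 : t ≠ 0) (hrst : r + s + t = 0)
    (hr'0 : r' ≠ 0) (hs'0 : s' ≠ 0) (ht'0 : t' ≠ 0) (hrst' : r' + s' + t' = 0)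
    (hunit : IsUnit r ∨ IsUnit s ∨ IsUnit t ∨ IsUnit r' ∨ IsUnit s' ∨ IsUnit t')
    (heq : fermatCMType (2 ^ n) r' s' t' = fermatCMType (2 ^ n) r s t) :
    (∃ u : ZMod (2 ^ n), IsUnit u ∧ ({r', s', t'} : Multiset (ZMod (2 ^ n))) = {u * r, u * s, u * t}) ∨
      ∃ w : ZMod (2 ^ n), IsUnit w ∧
        (((({w * r, w * s, w * t} : Multiset (ZMod (2 ^ n))) =
              {((2 ^ n - 2 ^ (0 + 2) : ℕ) : ZMod (2 ^ n)), ((2 ^ 0 : ℕ) : ZMod (2 ^ n)),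
                ((3 * 2 ^ 0 : ℕ) : ZMod (2 ^ n))} ∧
            ({w * r', w * s', w * t'} : Multiset (ZMod (2 ^ n))) =
              {((2 ^ (n - 1) - 2 ^ (0 + 1) : ℕ) : ZMod (2 ^ n)), ((2 ^ (n - 1) - 2 ^ 0 : ℕ) : ZMod (2 ^ n)),
                ((3 * 2 ^ 0 : ℕ) : ZMod (2 ^ n))}) ∨
            (({w * r, w * s, w * t} : Multiset (ZMod (2 ^ n))) =
              {((2 ^ (n - 1) - 2 ^ (0 + 1) : ℕ) : ZMod (2 ^ n)), ((2 ^ (n - 1) - 2 ^ 0 : ℕ) : ZMod (2 ^ n)),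
                ((3 * 2 ^ 0 : ℕ) : ZMod (2 ^ n))} ∧
            ({w * r', w * s', w * t'} : Multiset (ZMod (2 ^ n))) =
              {((2 ^ n - 2 ^ (0 + 2) : ℕ) : ZMod (2 ^ n)), ((2 ^ 0 : ℕ) : ZMod (2 ^ n)),
                ((3 * 2 ^ 0 : ℕ) : ZMod (2 ^ n))})) ∨
          ((({w * r, w * s, w * t} : Multiset (ZMod (2 ^ n))) =
              {((2 ^ n - 2 ^ (0 + 1) : ℕ) : ZMod (2 ^ n)), ((2 ^ 0 : ℕ) : ZMod (2 ^ n)),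
                ((2 ^ 0 : ℕ) : ZMod (2 ^ n))} ∧
            ({w * r', w * s', w * t'} : Multiset (ZMod (2 ^ n))) =
              {((2 ^ (n - 1) : ℕ) : ZMod (2 ^ n)), ((2 ^ 0 : ℕ) : ZMod (2 ^ n)),
                ((2 ^ (n - 1) - 2 ^ 0 : ℕ) : ZMod (2 ^ n))}) ∨
            (({w * r, w * s, w * t} : Multiset (ZMod (2 ^ n))) =
              {((2 ^ (n - 1) : ℕ) : ZMod (2 ^ n)), ((2 ^ 0 : ℕ) : ZMod (2 ^ n)),
                ((2 ^ (n - 1) - 2 ^ 0 : ℕ) : ZMod (2 ^ n))} ∧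
            ({w * r', w * s', w * t'} : Multiset (ZMod (2 ^ n))) =
              {((2 ^ n - 2 ^ (0 + 1) : ℕ) : ZMod (2 ^ n)), ((2 ^ 0 : ℕ) : ZMod (2 ^ n)),
                ((2 ^ 0 : ℕ) : ZMod (2 ^ n))})) ∨
          ((({w * r, w * s, w * t} : Multiset (ZMod (2 ^ n))) =
              {((2 ^ n - 2 ^ (0 + 1) : ℕ) : ZMod (2 ^ n)), ((2 ^ 0 : ℕ) : ZMod (2 ^ n)),
                ((2 ^ 0 : ℕ) : ZMod (2 ^ n))} ∧
            ({w * r', w * s', w * t'} : Multiset (ZMod (2 ^ n))) =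
              {((2 ^ (0 + 1) : ℕ) : ZMod (2 ^ n)), ((2 ^ (n - 1) - 2 ^ 0 : ℕ) : ZMod (2 ^ n)),
                ((2 ^ (n - 1) - 2 ^ 0 : ℕ) : ZMod (2 ^ n))}) ∨
            (({w * r, w * s, w * t} : Multiset (ZMod (2 ^ n))) =
              {((2 ^ (0 + 1) : ℕ) : ZMod (2 ^ n)), ((2 ^ (n - 1) - 2 ^ 0 : ℕ) : ZMod (2 ^ n)),
                ((2 ^ (n - 1) - 2 ^ 0 : ℕ) : ZMod (2 ^ n))} ∧
            ({w * r', w * s', w * t'} : Multiset (ZMod (2 ^ n))) =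
              {((2 ^ n - 2 ^ (0 + 1) : ℕ) : ZMod (2 ^ n)), ((2 ^ 0 : ℕ) : ZMod (2 ^ n)),
                ((2 ^ 0 : ℕ) : ZMod (2 ^ n))})) ∨
          ((({w * r, w * s, w * t} : Multiset (ZMod (2 ^ n))) =
              {((2 ^ (n - 1) - 2 ^ (0 + 1) : ℕ) : ZMod (2 ^ n)), ((2 ^ 0 : ℕ) : ZMod (2 ^ n)),
                ((2 ^ (n - 1) + 2 ^ 0 : ℕ) : ZMod (2 ^ n))} ∧
            ({w * r', w * s', w * t'} : Multiset (ZMod (2 ^ n))) =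
              {((2 ^ n - 2 ^ (0 + 2) : ℕ) : ZMod (2 ^ n)), ((2 ^ (0 + 1) : ℕ) : ZMod (2 ^ n)),
                ((2 ^ (0 + 1) : ℕ) : ZMod (2 ^ n))}) ∨
            (({w * r, w * s, w * t} : Multiset (ZMod (2 ^ n))) =
              {((2 ^ n - 2 ^ (0 + 2) : ℕ) : ZMod (2 ^ n)), ((2 ^ (0 + 1) : ℕ) : ZMod (2 ^ n)),
                ((2 ^ (0 + 1) : ℕ) : ZMod (2 ^ n))} ∧
            ({w * r', w * s', w * t'} : Multiset (ZMod (2 ^ n))) =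
              {((2 ^ (n - 1) - 2 ^ (0 + 1) : ℕ) : ZMod (2 ^ n)), ((2 ^ 0 : ℕ) : ZMod (2 ^ n)),
                ((2 ^ (n - 1) + 2 ^ 0 : ℕ) : ZMod (2 ^ n))})) ∨
          ((({w * r, w * s, w * t} : Multiset (ZMod (2 ^ n))) =
              {((2 ^ (n - 1) - 2 ^ (0 + 1) : ℕ) : ZMod (2 ^ n)), ((2 ^ 0 : ℕ) : ZMod (2 ^ n)),
                ((2 ^ (n - 1) + 2 ^ 0 : ℕ) : ZMod (2 ^ n))} ∧
            ({w * r', w * s', w * t'} : Multiset (ZMod (2 ^ n))) =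
              {((2 ^ (0 + 1) : ℕ) : ZMod (2 ^ n)), ((2 ^ (n - 2) - 2 ^ 0 : ℕ) : ZMod (2 ^ n)),
                ((3 * 2 ^ (n - 2) - 2 ^ 0 : ℕ) : ZMod (2 ^ n))}) ∨
            (({w * r, w * s, w * t} : Multiset (ZMod (2 ^ n))) =
              {((2 ^ (0 + 1) : ℕ) : ZMod (2 ^ n)), ((2 ^ (n - 2) - 2 ^ 0 : ℕ) : ZMod (2 ^ n)),
                ((3 * 2 ^ (n - 2) - 2 ^ 0 : ℕ) : ZMod (2 ^ n))} ∧
            ({w * r', w * s', w * t'} : Multiset (ZMod (2 ^ n))) =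
              {((2 ^ (n - 1) - 2 ^ (0 + 1) : ℕ) : ZMod (2 ^ n)), ((2 ^ 0 : ℕ) : ZMod (2 ^ n)),
                ((2 ^ (n - 1) + 2 ^ 0 : ℕ) : ZMod (2 ^ n))})) ∨
          ((({w * r, w * s, w * t} : Multiset (ZMod (2 ^ n))) =
              {((2 ^ (n - 1) - 2 ^ (0 + 1) : ℕ) : ZMod (2 ^ n)), ((2 ^ 0 : ℕ) : ZMod (2 ^ n)),
                ((2 ^ (n - 1) + 2 ^ 0 : ℕ) : ZMod (2 ^ n))} ∧
            ({w * r', w * s', w * t'} : Multiset (ZMod (2 ^ n))) =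
              {((2 ^ (n - 1) : ℕ) : ZMod (2 ^ n)), ((2 ^ (0 + 1) : ℕ) : ZMod (2 ^ n)),
                ((2 ^ (n - 1) - 2 ^ (0 + 1) : ℕ) : ZMod (2 ^ n))}) ∨
            (({w * r, w * s, w * t} : Multiset (ZMod (2 ^ n))) =
              {((2 ^ (n - 1) : ℕ) : ZMod (2 ^ n)), ((2 ^ (0 + 1) : ℕ) : ZMod (2 ^ n)),
                ((2 ^ (n - 1) - 2 ^ (0 + 1) : ℕ) : ZMod (2 ^ n))} ∧
            ({w * r', w * s', w * t'} : Multiset (ZMod (2 ^ n))) =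
              {((2 ^ (n - 1) - 2 ^ (0 + 1) : ℕ) : ZMod (2 ^ n)), ((2 ^ 0 : ℕ) : ZMod (2 ^ n)),
                ((2 ^ (n - 1) + 2 ^ 0 : ℕ) : ZMod (2 ^ n))})) ∨
          ((({w * r, w * s, w * t} : Multiset (ZMod (2 ^ n))) =
              {((2 ^ (0 + 1) : ℕ) : ZMod (2 ^ n)), ((2 ^ (n - 2) - 2 ^ 0 : ℕ) : ZMod (2 ^ n)),
                ((3 * 2 ^ (n - 2) - 2 ^ 0 : ℕ) : ZMod (2 ^ n))} ∧
            ({w * r', w * s', w * t'} : Multiset (ZMod (2 ^ n))) =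
              {((2 ^ n - 2 ^ (0 + 2) : ℕ) : ZMod (2 ^ n)), ((2 ^ (0 + 1) : ℕ) : ZMod (2 ^ n)),
                ((2 ^ (0 + 1) : ℕ) : ZMod (2 ^ n))}) ∨
            (({w * r, w * s, w * t} : Multiset (ZMod (2 ^ n))) =
              {((2 ^ n - 2 ^ (0 + 2) : ℕ) : ZMod (2 ^ n)), ((2 ^ (0 + 1) : ℕ) : ZMod (2 ^ n)),
                ((2 ^ (0 + 1) : ℕ) : ZMod (2 ^ n))} ∧
            ({w * r', w * s', w * t'} : Multiset (ZMod (2 ^ n))) =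
              {((2 ^ (0 + 1) : ℕ) : ZMod (2 ^ n)), ((2 ^ (n - 2) - 2 ^ 0 : ℕ) : ZMod (2 ^ n)),
                ((3 * 2 ^ (n - 2) - 2 ^ 0 : ℕ) : ZMod (2 ^ n))}))) := by
  subst hn
  have e8 : 2 ^ 3 = 8 := by norm_num
  set φ := ZMod.ringEquivCongr e8 with hφ
  have ht : t = -r - s := by linear_combination hrst
  have ht' : t' = -r' - s' := by linear_combination hrst'
  have cop : ∀ {x : ZMod (2 ^ 3)}, IsUnit x → (φ x).val.Coprime 8 := by
    intro x hx
    have h := hx.map φ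
    rw [← ZMod.natCast_zmod_val (φ x)] at h
    exact (ZMod.isUnit_iff_coprime _ _).1 h
  have nz : ∀ {x : ZMod (2 ^ 3)}, x ≠ 0 → φ x ≠ 0 := fun hx h0 => hx (φ.injective (by rw [h0, map_zero]))
  have hφt : -φ r - φ s = φ t := by rw [ht, map_sub, map_neg]
  have hφt' : -φ r' - φ s' = φ t' := by rw [ht', map_sub, map_neg]
  have Heq : fermatCMType 8 (φ r) (φ s) (-φ r - φ s) = fermatCMType 8 (φ r') (φ s') (-φ r' - φ s') := by
    rw [hφt, hφt']
    exact ((fermatCMType_ringEquivCongr_eq_iff₂ e8 r s t r' s' t').2 heq).symm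
  have hunit8 : (φ r).val.Coprime 8 ∨ (φ s).val.Coprime 8 ∨ (-φ r - φ s).val.Coprime 8 ∨
      (φ r').val.Coprime 8 ∨ (φ s').val.Coprime 8 ∨ (-φ r' - φ s').val.Coprime 8 := by
    rw [hφt, hφt']
    rcases hunit with h | h | h | h | h | h
    · exact Or.inl (cop h)
    · exact Or.inr (Or.inl (cop h))
    · exact Or.inr (Or.inr (Or.inl (cop h)))
    · exact Or.inr (Or.inr (Or.inr (Or.inl (cop h))))
    · exact Or.inr (Or.inr (Or.inr (Or.inr (Or.inl (cop h)))))
    · exact Or.inr (Or.inr (Or.inr (Or.inr (Or.inr (cop h)))))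
  obtain ⟨u, hu, h5⟩ := exists_unit_of_fermatCMType_eq_eight (φ r) (φ s) (φ r') (φ s') (nz hr0) (nz hs0)
    (by rw [hφt]; exact nz ht0) (nz hr'0) (nz hs'0) (by rw [hφt']; exact nz ht'0) hunit8 Heq
  rw [hφt, hφt'] at h5
  have huu : IsUnit u := by
    have h := (ZMod.isUnit_iff_coprime u.val 8).2 hu
    rwa [ZMod.natCast_zmod_val] at h
  have hU : IsUnit (φ.symm u) := huu.map φ.symm
  have back : ∀ {a b c : ZMod (2 ^ 3)} {X : Multiset (ZMod 8)},
      ({u * φ a, u * φ b, u * φ c} : Multiset (ZMod 8)) = X →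
      ({φ.symm u * a, φ.symm u * b, φ.symm u * c} : Multiset (ZMod (2 ^ 3))) = X.map φ.symm := by
    intro a b c X h
    rw [← h, map_triple₂]
    simp only [map_mul, RingEquiv.symm_apply_apply]
  have perm8 : (({φ r', φ s', φ t'} : Multiset (ZMod 8)).map φ.symm) = {r', s', t'} := by
    rw [map_triple₂]
    simp only [RingEquiv.symm_apply_apply]
  have cAE : ((({1, 1, 6} : Multiset (ZMod 8)).map φ.symm) : Multiset (ZMod (2 ^ 3))) =
      {((2 ^ 3 - 2 ^ (0 + 1) : ℕ) : ZMod (2 ^ 3)), ((2 ^ 0 : ℕ) : ZMod (2 ^ 3)),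
        ((2 ^ 0 : ℕ) : ZMod (2 ^ 3))} := by
    rw [map_triple₂]
    simp only [map_one, map_ofNat]
    decide
  have cBE1 : ((({1, 3, 4} : Multiset (ZMod 8)).map φ.symm) : Multiset (ZMod (2 ^ 3))) =
      {((2 ^ (3 - 1) : ℕ) : ZMod (2 ^ 3)), ((2 ^ 0 : ℕ) : ZMod (2 ^ 3)),
        ((2 ^ (3 - 1) - 2 ^ 0 : ℕ) : ZMod (2 ^ 3))} := by
    rw [map_triple₂]
    simp only [map_one, map_ofNat]
    decide
  have cAA : ((({1, 2, 5} : Multiset (ZMod 8)).map φ.symm) : Multiset (ZMod (2 ^ 3))) =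
      {((2 ^ (3 - 1) - 2 ^ (0 + 1) : ℕ) : ZMod (2 ^ 3)), ((2 ^ 0 : ℕ) : ZMod (2 ^ 3)),
        ((2 ^ (3 - 1) + 2 ^ 0 : ℕ) : ZMod (2 ^ 3))} := by
    rw [map_triple₂]
    simp only [map_one, map_ofNat]
    decide
  have cBA1 : ((({2, 2, 4} : Multiset (ZMod 8)).map φ.symm) : Multiset (ZMod (2 ^ 3))) =
      {((2 ^ 3 - 2 ^ (0 + 2) : ℕ) : ZMod (2 ^ 3)), ((2 ^ (0 + 1) : ℕ) : ZMod (2 ^ 3)),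
        ((2 ^ (0 + 1) : ℕ) : ZMod (2 ^ 3))} := by
    rw [map_triple₂]
    simp only [map_ofNat]
    decide
  rcases h5 with h | ⟨hA, hB⟩ | ⟨hA, hB⟩ | ⟨hA, hB⟩ | ⟨hA, hB⟩
  · left
    refine ⟨φ.symm u, hU, ?_⟩
    have h1 := back h
    rw [perm8] at h1
    exact h1.symm
  · right
    refine ⟨φ.symm u, hU, Or.inr (Or.inl (Or.inl ⟨?_, ?_⟩))⟩
    · have h1 := back hA
      rwa [cAE] at h1
    · have h1 := back hB
      rwa [cBE1] at h1
  · right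
    refine ⟨φ.symm u, hU, Or.inr (Or.inl (Or.inr ⟨?_, ?_⟩))⟩
    · have h1 := back hA
      rwa [cBE1] at h1
    · have h1 := back hB
      rwa [cAE] at h1
  · right
    refine ⟨φ.symm u, hU, Or.inr (Or.inr (Or.inr (Or.inl (Or.inl ⟨?_, ?_⟩))))⟩
    · have h1 := back hA
      rwa [cAA] at h1
    · have h1 := back hB
      rwa [cBA1] at h1
  · right
    refine ⟨φ.symm u, hU, Or.inr (Or.inr (Or.inr (Or.inl (Or.inr ⟨?_, ?_⟩))))⟩
    · have h1 := back hA
      rwa [cBA1] at h1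
    · have h1 := back hB
      rwa [cAA] at h1

/-- The induction behind `obvious_or_exceptional_of_fermatCMType_eq_twoPow_all` (statement with all variables bound, for `induction n`).
[cite: KoblitzRohrlich1978, Theorem 4 (p. 1186), §5 Proposition (p. 1200), §1 (pp. 1183–1185)] -/
private theorem twoPow_all_aux :
    ∀ n : ℕ, n ≠ 0 → ∀ r s t r' s' t' : ZMod (2 ^ n), r ≠ 0 → s ≠ 0 → t ≠ 0 → r + s + t = 0 →
      r' ≠ 0 → s' ≠ 0 → t' ≠ 0 → r' + s' + t' = 0 → fermatCMType (2 ^ n) r' s' t' = fermatCMType (2 ^ n) r s t →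
      (∃ u : ZMod (2 ^ n), IsUnit u ∧ ({r', s', t'} : Multiset (ZMod (2 ^ n))) = {u * r, u * s, u * t}) ∨
      ∃ m : ℕ, m + 3 ≤ n ∧ ∃ w : ZMod (2 ^ n), IsUnit w ∧
        (((({w * r, w * s, w * t} : Multiset (ZMod (2 ^ n))) =
            {((2 ^ n - 2 ^ (m + 2) : ℕ) : ZMod (2 ^ n)), ((2 ^ m : ℕ) : ZMod (2 ^ n)),
              ((3 * 2 ^ m : ℕ) : ZMod (2 ^ n))} ∧
          ({w * r', w * s', w * t'} : Multiset (ZMod (2 ^ n))) =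
            {((2 ^ (n - 1) - 2 ^ (m + 1) : ℕ) : ZMod (2 ^ n)), ((2 ^ (n - 1) - 2 ^ m : ℕ) : ZMod (2 ^ n)),
              ((3 * 2 ^ m : ℕ) : ZMod (2 ^ n))}) ∨
          (({w * r, w * s, w * t} : Multiset (ZMod (2 ^ n))) =
            {((2 ^ (n - 1) - 2 ^ (m + 1) : ℕ) : ZMod (2 ^ n)), ((2 ^ (n - 1) - 2 ^ m : ℕ) : ZMod (2 ^ n)),
              ((3 * 2 ^ m : ℕ) : ZMod (2 ^ n))} ∧
          ({w * r', w * s', w * t'} : Multiset (ZMod (2 ^ n))) =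
            {((2 ^ n - 2 ^ (m + 2) : ℕ) : ZMod (2 ^ n)), ((2 ^ m : ℕ) : ZMod (2 ^ n)),
              ((3 * 2 ^ m : ℕ) : ZMod (2 ^ n))})) ∨
        ((({w * r, w * s, w * t} : Multiset (ZMod (2 ^ n))) =
            {((2 ^ n - 2 ^ (m + 1) : ℕ) : ZMod (2 ^ n)), ((2 ^ m : ℕ) : ZMod (2 ^ n)),
              ((2 ^ m : ℕ) : ZMod (2 ^ n))} ∧
          ({w * r', w * s', w * t'} : Multiset (ZMod (2 ^ n))) =
            {((2 ^ (n - 1) : ℕ) : ZMod (2 ^ n)), ((2 ^ m : ℕ) : ZMod (2 ^ n)),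
              ((2 ^ (n - 1) - 2 ^ m : ℕ) : ZMod (2 ^ n))}) ∨
          (({w * r, w * s, w * t} : Multiset (ZMod (2 ^ n))) =
            {((2 ^ (n - 1) : ℕ) : ZMod (2 ^ n)), ((2 ^ m : ℕ) : ZMod (2 ^ n)),
              ((2 ^ (n - 1) - 2 ^ m : ℕ) : ZMod (2 ^ n))} ∧
          ({w * r', w * s', w * t'} : Multiset (ZMod (2 ^ n))) =
            {((2 ^ n - 2 ^ (m + 1) : ℕ) : ZMod (2 ^ n)), ((2 ^ m : ℕ) : ZMod (2 ^ n)),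
              ((2 ^ m : ℕ) : ZMod (2 ^ n))})) ∨
        ((({w * r, w * s, w * t} : Multiset (ZMod (2 ^ n))) =
            {((2 ^ n - 2 ^ (m + 1) : ℕ) : ZMod (2 ^ n)), ((2 ^ m : ℕ) : ZMod (2 ^ n)),
              ((2 ^ m : ℕ) : ZMod (2 ^ n))} ∧
          ({w * r', w * s', w * t'} : Multiset (ZMod (2 ^ n))) =
            {((2 ^ (m + 1) : ℕ) : ZMod (2 ^ n)), ((2 ^ (n - 1) - 2 ^ m : ℕ) : ZMod (2 ^ n)),
              ((2 ^ (n - 1) - 2 ^ m : ℕ) : ZMod (2 ^ n))}) ∨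
          (({w * r, w * s, w * t} : Multiset (ZMod (2 ^ n))) =
            {((2 ^ (m + 1) : ℕ) : ZMod (2 ^ n)), ((2 ^ (n - 1) - 2 ^ m : ℕ) : ZMod (2 ^ n)),
              ((2 ^ (n - 1) - 2 ^ m : ℕ) : ZMod (2 ^ n))} ∧
          ({w * r', w * s', w * t'} : Multiset (ZMod (2 ^ n))) =
            {((2 ^ n - 2 ^ (m + 1) : ℕ) : ZMod (2 ^ n)), ((2 ^ m : ℕ) : ZMod (2 ^ n)),
              ((2 ^ m : ℕ) : ZMod (2 ^ n))})) ∨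
        ((({w * r, w * s, w * t} : Multiset (ZMod (2 ^ n))) =
            {((2 ^ (n - 1) - 2 ^ (m + 1) : ℕ) : ZMod (2 ^ n)), ((2 ^ m : ℕ) : ZMod (2 ^ n)),
              ((2 ^ (n - 1) + 2 ^ m : ℕ) : ZMod (2 ^ n))} ∧
          ({w * r', w * s', w * t'} : Multiset (ZMod (2 ^ n))) =
            {((2 ^ n - 2 ^ (m + 2) : ℕ) : ZMod (2 ^ n)), ((2 ^ (m + 1) : ℕ) : ZMod (2 ^ n)),
              ((2 ^ (m + 1) : ℕ) : ZMod (2 ^ n))}) ∨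
          (({w * r, w * s, w * t} : Multiset (ZMod (2 ^ n))) =
            {((2 ^ n - 2 ^ (m + 2) : ℕ) : ZMod (2 ^ n)), ((2 ^ (m + 1) : ℕ) : ZMod (2 ^ n)),
              ((2 ^ (m + 1) : ℕ) : ZMod (2 ^ n))} ∧
          ({w * r', w * s', w * t'} : Multiset (ZMod (2 ^ n))) =
            {((2 ^ (n - 1) - 2 ^ (m + 1) : ℕ) : ZMod (2 ^ n)), ((2 ^ m : ℕ) : ZMod (2 ^ n)),
              ((2 ^ (n - 1) + 2 ^ m : ℕ) : ZMod (2 ^ n))})) ∨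
        ((({w * r, w * s, w * t} : Multiset (ZMod (2 ^ n))) =
            {((2 ^ (n - 1) - 2 ^ (m + 1) : ℕ) : ZMod (2 ^ n)), ((2 ^ m : ℕ) : ZMod (2 ^ n)),
              ((2 ^ (n - 1) + 2 ^ m : ℕ) : ZMod (2 ^ n))} ∧
          ({w * r', w * s', w * t'} : Multiset (ZMod (2 ^ n))) =
            {((2 ^ (m + 1) : ℕ) : ZMod (2 ^ n)), ((2 ^ (n - 2) - 2 ^ m : ℕ) : ZMod (2 ^ n)),
              ((3 * 2 ^ (n - 2) - 2 ^ m : ℕ) : ZMod (2 ^ n))}) ∨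
          (({w * r, w * s, w * t} : Multiset (ZMod (2 ^ n))) =
            {((2 ^ (m + 1) : ℕ) : ZMod (2 ^ n)), ((2 ^ (n - 2) - 2 ^ m : ℕ) : ZMod (2 ^ n)),
              ((3 * 2 ^ (n - 2) - 2 ^ m : ℕ) : ZMod (2 ^ n))} ∧
          ({w * r', w * s', w * t'} : Multiset (ZMod (2 ^ n))) =
            {((2 ^ (n - 1) - 2 ^ (m + 1) : ℕ) : ZMod (2 ^ n)), ((2 ^ m : ℕ) : ZMod (2 ^ n)),
              ((2 ^ (n - 1) + 2 ^ m : ℕ) : ZMod (2 ^ n))})) ∨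
        ((({w * r, w * s, w * t} : Multiset (ZMod (2 ^ n))) =
            {((2 ^ (n - 1) - 2 ^ (m + 1) : ℕ) : ZMod (2 ^ n)), ((2 ^ m : ℕ) : ZMod (2 ^ n)),
              ((2 ^ (n - 1) + 2 ^ m : ℕ) : ZMod (2 ^ n))} ∧
          ({w * r', w * s', w * t'} : Multiset (ZMod (2 ^ n))) =
            {((2 ^ (n - 1) : ℕ) : ZMod (2 ^ n)), ((2 ^ (m + 1) : ℕ) : ZMod (2 ^ n)),
              ((2 ^ (n - 1) - 2 ^ (m + 1) : ℕ) : ZMod (2 ^ n))}) ∨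
          (({w * r, w * s, w * t} : Multiset (ZMod (2 ^ n))) =
            {((2 ^ (n - 1) : ℕ) : ZMod (2 ^ n)), ((2 ^ (m + 1) : ℕ) : ZMod (2 ^ n)),
              ((2 ^ (n - 1) - 2 ^ (m + 1) : ℕ) : ZMod (2 ^ n))} ∧
          ({w * r', w * s', w * t'} : Multiset (ZMod (2 ^ n))) =
            {((2 ^ (n - 1) - 2 ^ (m + 1) : ℕ) : ZMod (2 ^ n)), ((2 ^ m : ℕ) : ZMod (2 ^ n)),
              ((2 ^ (n - 1) + 2 ^ m : ℕ) : ZMod (2 ^ n))})) ∨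
        ((({w * r, w * s, w * t} : Multiset (ZMod (2 ^ n))) =
            {((2 ^ (m + 1) : ℕ) : ZMod (2 ^ n)), ((2 ^ (n - 2) - 2 ^ m : ℕ) : ZMod (2 ^ n)),
              ((3 * 2 ^ (n - 2) - 2 ^ m : ℕ) : ZMod (2 ^ n))} ∧
          ({w * r', w * s', w * t'} : Multiset (ZMod (2 ^ n))) =
            {((2 ^ n - 2 ^ (m + 2) : ℕ) : ZMod (2 ^ n)), ((2 ^ (m + 1) : ℕ) : ZMod (2 ^ n)),
              ((2 ^ (m + 1) : ℕ) : ZMod (2 ^ n))}) ∨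
          (({w * r, w * s, w * t} : Multiset (ZMod (2 ^ n))) =
            {((2 ^ n - 2 ^ (m + 2) : ℕ) : ZMod (2 ^ n)), ((2 ^ (m + 1) : ℕ) : ZMod (2 ^ n)),
              ((2 ^ (m + 1) : ℕ) : ZMod (2 ^ n))} ∧
          ({w * r', w * s', w * t'} : Multiset (ZMod (2 ^ n))) =
            {((2 ^ (m + 1) : ℕ) : ZMod (2 ^ n)), ((2 ^ (n - 2) - 2 ^ m : ℕ) : ZMod (2 ^ n)),
              ((3 * 2 ^ (n - 2) - 2 ^ m : ℕ) : ZMod (2 ^ n))}))) := by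
  haveI h2 : Fact (Nat.Prime 2) := ⟨Nat.prime_two⟩
  intro n
  induction n with
  | zero => exact fun h => (h rfl).elim
  | succ k ih =>
    intro _ r s t r' s' t' hr0 hs0 ht0 hrst hr'0 hs'0 ht'0 hrst' heq
    by_cases hunit : IsUnit r ∨ IsUnit s ∨ IsUnit t ∨ IsUnit r' ∨ IsUnit s' ∨ IsUnit t'
    · -- a unit among the six entries
      rcases Nat.lt_or_ge k 3 with hk3 | hk3
      · -- the levels `2`, `4`, `8`
        interval_cases k
        · exact (no_triple_two (n := 0 + 1) rfl hr0 hs0 ht0 hrst).elim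
        · exact Or.inl (obvious_four (n := 1 + 1) rfl hr0 hs0 ht0 hrst hr'0 hs'0 ht'0 hrst')
        · rcases base_eight (n := 2 + 1) rfl hr0 hs0 ht0 hrst hr'0 hs'0 ht'0 hrst' hunit heq with h | ⟨w, hw, hK⟩
          · exact Or.inl h
          · exact Or.inr ⟨0, le_refl _, w, hw, hK⟩
      · -- level `≥ 16`: the §5 Proposition (sibling `perm_or_exceptional_of_fermatCMType_eq_twoPow`)
        have hk4 : 4 ≤ k + 1 := by omega
        obtain ⟨d1, d2, d3, d4, d5, d6, d7, d8, d9⟩ := twoPow_triples_zero_eq (n := k + 1) (by omega)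
        rcases perm_or_exceptional_of_fermatCMType_eq_twoPow hk4 hr0 hs0 ht0 hrst hr'0 hs'0 ht'0 hrst' hunit heq with
          hperm | ⟨w, hw, hK⟩
        · exact Or.inl ⟨1, isUnit_one, by rw [one_mul, one_mul, one_mul]; exact hperm⟩
        · refine Or.inr ⟨0, by omega, w, hw, ?_⟩
          rw [← d1, ← d2, ← d3, ← d4, ← d5, ← d6, ← d7, ← d8, ← d9] at hK
          exact hK
    · -- all six entries even: descend to level `2ᵏ`
      simp only [not_or] at hunit
      obtain ⟨hru, hsu, htu, hr'u, hs'u, ht'u⟩ := hunit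
      have hk : k ≠ 0 := by
        have h2 := two_le_of_not_isUnit (p := 2) hr0 hru
        omega
      obtain ⟨r₁, er, hr₁, Er⟩ := exists_val_eq_mul_of_not_isUnit hr0 hru
      obtain ⟨s₁, es, hs₁, Es⟩ := exists_val_eq_mul_of_not_isUnit hs0 hsu
      obtain ⟨t₁, et, ht₁, Et⟩ := exists_val_eq_mul_of_not_isUnit ht0 htu
      obtain ⟨r₁', er', hr₁', Er'⟩ := exists_val_eq_mul_of_not_isUnit hr'0 hr'u
      obtain ⟨s₁', es', hs₁', Es'⟩ := exists_val_eq_mul_of_not_isUnit hs'0 hs'u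
      obtain ⟨t₁', et', ht₁', Et'⟩ := exists_val_eq_mul_of_not_isUnit ht'0 ht'u
      have hsum := natCast_add_eq_zero_of_val_eq_mul hrst er es et
      have hsum' := natCast_add_eq_zero_of_val_eq_mul hrst' er' es' et'
      have heq1 : fermatCMType (2 * 2 ^ k) ((2 * r₁' : ℕ) : ZMod (2 * 2 ^ k)) ((2 * s₁' : ℕ) : ZMod (2 * 2 ^ k))
          ((2 * t₁' : ℕ) : ZMod (2 * 2 ^ k)) =
          fermatCMType (2 * 2 ^ k) ((2 * r₁ : ℕ) : ZMod (2 * 2 ^ k)) ((2 * s₁ : ℕ) : ZMod (2 * 2 ^ k))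
            ((2 * t₁ : ℕ) : ZMod (2 * 2 ^ k)) := by
        rw [← Er, ← Es, ← Et, ← Er', ← Es', ← Et', fermatCMType_ringEquivCongr_eq_iff₂]
        exact heq
      have heqk := fermatCMType_eq_of_fermatCMType_level_mul_eq (by norm_num : 0 < 2) heq1
      have R : ∀ {a : ZMod (2 ^ (k + 1))} {a₁ : ℕ}, a.val = 2 * a₁ → ((2 * a₁ : ℕ) : ZMod (2 ^ (k + 1))) = a := by
        intro a a₁ h
        rw [← h, ZMod.natCast_zmod_val]
      rcases ih hk _ _ _ _ _ _ hr₁ hs₁ ht₁ hsum hr₁' hs₁' ht₁' hsum' heqk with ⟨u₀, hu₀, hob⟩ | ⟨m₀, hm₀, w₀, hw₀, hK⟩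
      · -- an obvious equivalence lifts
        left
        obtain ⟨W, hW, hlift⟩ := exists_unit_multiset_mul_eq_succ (p := 2) hu₀
        have h1 := hlift _ _ _ _ _ _ hob.symm
        rw [R er, R es, R et, R er', R es', R et'] at h1
        exact ⟨W, hW, h1.symm⟩
      · -- a listed pair lifts with `m ↦ m + 1`
        right
        obtain ⟨W, hW, hlift⟩ := exists_unit_multiset_mul_eq_succ (p := 2) hw₀
        refine ⟨m₀ + 1, by omega, W, hW, ?_⟩
        have L : ∀ {a b c x y z : ℕ} {ra rb rc : ZMod (2 ^ (k + 1))}, ra.val = 2 * a → rb.val = 2 * b → rc.val = 2 * c →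
            ({w₀ * (a : ZMod (2 ^ k)), w₀ * (b : ZMod (2 ^ k)), w₀ * (c : ZMod (2 ^ k))} : Multiset (ZMod (2 ^ k))) =
                {(x : ZMod (2 ^ k)), (y : ZMod (2 ^ k)), (z : ZMod (2 ^ k))} →
            ({W * ra, W * rb, W * rc} : Multiset (ZMod (2 ^ (k + 1)))) =
              {((2 * x : ℕ) : ZMod (2 ^ (k + 1))), ((2 * y : ℕ) : ZMod (2 ^ (k + 1))), ((2 * z : ℕ) : ZMod (2 ^ (k + 1)))} := by
          intro a b c x y z ra rb rc ha hb hc h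
          have h1 := hlift _ _ _ _ _ _ h
          rw [R ha, R hb, R hc] at h1
          exact h1
        -- the arithmetic of the lift
        have g1 : 2 ^ (k + 1 - 1) = 2 * 2 ^ (k - 1) := by
          rw [← pow_succ']
          congr 1
          omega
        have g2 : 2 ^ (k + 1 - 2) = 2 * 2 ^ (k - 2) := by
          rw [← pow_succ']
          congr 1
          omega
        have g3 : 2 ^ (m₀ + 1) = 2 * 2 ^ m₀ := pow_succ' 2 m₀
        have g4 : 2 ^ (m₀ + 1 + 1) = 2 * 2 ^ (m₀ + 1) := pow_succ' 2 (m₀ + 1)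
        have g5 : 2 ^ (m₀ + 1 + 2) = 2 * 2 ^ (m₀ + 2) := by
          rw [show m₀ + 1 + 2 = m₀ + 2 + 1 by omega, pow_succ']
        have g6 : 2 ^ (k + 1) = 2 * 2 ^ k := pow_succ' 2 k
        have f1 : 2 * (2 ^ k - 2 ^ (m₀ + 2)) = 2 ^ (k + 1) - 2 ^ (m₀ + 1 + 2) := by rw [Nat.mul_sub, g6, g5]
        have f2 : 2 * 2 ^ m₀ = 2 ^ (m₀ + 1) := g3.symm
        have f3 : 2 * (3 * 2 ^ m₀) = 3 * 2 ^ (m₀ + 1) := by rw [g3, Nat.mul_left_comm]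
        have f4 : 2 * (2 ^ (k - 1) - 2 ^ (m₀ + 1)) = 2 ^ (k + 1 - 1) - 2 ^ (m₀ + 1 + 1) := by rw [Nat.mul_sub, g1, g4]
        have f5 : 2 * (2 ^ (k - 1) - 2 ^ m₀) = 2 ^ (k + 1 - 1) - 2 ^ (m₀ + 1) := by rw [Nat.mul_sub, g1, g3]
        have f6 : 2 * (2 ^ k - 2 ^ (m₀ + 1)) = 2 ^ (k + 1) - 2 ^ (m₀ + 1 + 1) := by rw [Nat.mul_sub, g6, g4]
        have f7 : 2 * 2 ^ (k - 1) = 2 ^ (k + 1 - 1) := g1.symm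
        have f8 : 2 * 2 ^ (m₀ + 1) = 2 ^ (m₀ + 1 + 1) := g4.symm
        have f9 : 2 * (2 ^ (k - 1) + 2 ^ m₀) = 2 ^ (k + 1 - 1) + 2 ^ (m₀ + 1) := by rw [mul_add, g1, g3]
        have f10 : 2 * (2 ^ (k - 2) - 2 ^ m₀) = 2 ^ (k + 1 - 2) - 2 ^ (m₀ + 1) := by rw [Nat.mul_sub, g2, g3]
        have f11 : 2 * (3 * 2 ^ (k - 2) - 2 ^ m₀) = 3 * 2 ^ (k + 1 - 2) - 2 ^ (m₀ + 1) := by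
          rw [Nat.mul_sub, g2, g3, Nat.mul_left_comm 2 3 (2 ^ (k - 2))]
        have A_AD : ({((2 * (2 ^ k - 2 ^ (m₀ + 2)) : ℕ) : ZMod (2 ^ (k + 1))), ((2 * (2 ^ m₀) : ℕ) : ZMod (2 ^ (k + 1))),
            ((2 * (3 * 2 ^ m₀) : ℕ) : ZMod (2 ^ (k + 1)))} : Multiset (ZMod (2 ^ (k + 1)))) =
            {((2 ^ (k + 1) - 2 ^ (m₀ + 1 + 2) : ℕ) : ZMod (2 ^ (k + 1))), ((2 ^ (m₀ + 1) : ℕ) : ZMod (2 ^ (k + 1))),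
            ((3 * 2 ^ (m₀ + 1) : ℕ) : ZMod (2 ^ (k + 1)))} := by
          rw [f1, f2, f3]
        have A_BD : ({((2 * (2 ^ (k - 1) - 2 ^ (m₀ + 1)) : ℕ) : ZMod (2 ^ (k + 1))), ((2 * (2 ^ (k - 1) - 2 ^ m₀) : ℕ) : ZMod (2 ^ (k + 1))),
            ((2 * (3 * 2 ^ m₀) : ℕ) : ZMod (2 ^ (k + 1)))} : Multiset (ZMod (2 ^ (k + 1)))) =
            {((2 ^ (k + 1 - 1) - 2 ^ (m₀ + 1 + 1) : ℕ) : ZMod (2 ^ (k + 1))), ((2 ^ (k + 1 - 1) - 2 ^ (m₀ + 1) : ℕ) : ZMod (2 ^ (k + 1))),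
            ((3 * 2 ^ (m₀ + 1) : ℕ) : ZMod (2 ^ (k + 1)))} := by
          rw [f4, f5, f3]
        have A_AE : ({((2 * (2 ^ k - 2 ^ (m₀ + 1)) : ℕ) : ZMod (2 ^ (k + 1))), ((2 * (2 ^ m₀) : ℕ) : ZMod (2 ^ (k + 1))),
            ((2 * (2 ^ m₀) : ℕ) : ZMod (2 ^ (k + 1)))} : Multiset (ZMod (2 ^ (k + 1)))) =
            {((2 ^ (k + 1) - 2 ^ (m₀ + 1 + 1) : ℕ) : ZMod (2 ^ (k + 1))), ((2 ^ (m₀ + 1) : ℕ) : ZMod (2 ^ (k + 1))),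
            ((2 ^ (m₀ + 1) : ℕ) : ZMod (2 ^ (k + 1)))} := by
          rw [f6, f2]
        have A_BE1 : ({((2 * (2 ^ (k - 1)) : ℕ) : ZMod (2 ^ (k + 1))), ((2 * (2 ^ m₀) : ℕ) : ZMod (2 ^ (k + 1))),
            ((2 * (2 ^ (k - 1) - 2 ^ m₀) : ℕ) : ZMod (2 ^ (k + 1)))} : Multiset (ZMod (2 ^ (k + 1)))) =
            {((2 ^ (k + 1 - 1) : ℕ) : ZMod (2 ^ (k + 1))), ((2 ^ (m₀ + 1) : ℕ) : ZMod (2 ^ (k + 1))),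
            ((2 ^ (k + 1 - 1) - 2 ^ (m₀ + 1) : ℕ) : ZMod (2 ^ (k + 1)))} := by
          rw [f7, f2, f5]
        have A_BE2 : ({((2 * (2 ^ (m₀ + 1)) : ℕ) : ZMod (2 ^ (k + 1))), ((2 * (2 ^ (k - 1) - 2 ^ m₀) : ℕ) : ZMod (2 ^ (k + 1))),
            ((2 * (2 ^ (k - 1) - 2 ^ m₀) : ℕ) : ZMod (2 ^ (k + 1)))} : Multiset (ZMod (2 ^ (k + 1)))) =
            {((2 ^ (m₀ + 1 + 1) : ℕ) : ZMod (2 ^ (k + 1))), ((2 ^ (k + 1 - 1) - 2 ^ (m₀ + 1) : ℕ) : ZMod (2 ^ (k + 1))),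
            ((2 ^ (k + 1 - 1) - 2 ^ (m₀ + 1) : ℕ) : ZMod (2 ^ (k + 1)))} := by
          rw [f8, f5]
        have A_AA : ({((2 * (2 ^ (k - 1) - 2 ^ (m₀ + 1)) : ℕ) : ZMod (2 ^ (k + 1))), ((2 * (2 ^ m₀) : ℕ) : ZMod (2 ^ (k + 1))),
            ((2 * (2 ^ (k - 1) + 2 ^ m₀) : ℕ) : ZMod (2 ^ (k + 1)))} : Multiset (ZMod (2 ^ (k + 1)))) =
            {((2 ^ (k + 1 - 1) - 2 ^ (m₀ + 1 + 1) : ℕ) : ZMod (2 ^ (k + 1))), ((2 ^ (m₀ + 1) : ℕ) : ZMod (2 ^ (k + 1))),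
            ((2 ^ (k + 1 - 1) + 2 ^ (m₀ + 1) : ℕ) : ZMod (2 ^ (k + 1)))} := by
          rw [f4, f2, f9]
        have A_BA1 : ({((2 * (2 ^ k - 2 ^ (m₀ + 2)) : ℕ) : ZMod (2 ^ (k + 1))), ((2 * (2 ^ (m₀ + 1)) : ℕ) : ZMod (2 ^ (k + 1))),
            ((2 * (2 ^ (m₀ + 1)) : ℕ) : ZMod (2 ^ (k + 1)))} : Multiset (ZMod (2 ^ (k + 1)))) =
            {((2 ^ (k + 1) - 2 ^ (m₀ + 1 + 2) : ℕ) : ZMod (2 ^ (k + 1))), ((2 ^ (m₀ + 1 + 1) : ℕ) : ZMod (2 ^ (k + 1))),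
            ((2 ^ (m₀ + 1 + 1) : ℕ) : ZMod (2 ^ (k + 1)))} := by
          rw [f1, f8]
        have A_BA2 : ({((2 * (2 ^ (k - 1)) : ℕ) : ZMod (2 ^ (k + 1))), ((2 * (2 ^ (m₀ + 1)) : ℕ) : ZMod (2 ^ (k + 1))),
            ((2 * (2 ^ (k - 1) - 2 ^ (m₀ + 1)) : ℕ) : ZMod (2 ^ (k + 1)))} : Multiset (ZMod (2 ^ (k + 1)))) =
            {((2 ^ (k + 1 - 1) : ℕ) : ZMod (2 ^ (k + 1))), ((2 ^ (m₀ + 1 + 1) : ℕ) : ZMod (2 ^ (k + 1))),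
            ((2 ^ (k + 1 - 1) - 2 ^ (m₀ + 1 + 1) : ℕ) : ZMod (2 ^ (k + 1)))} := by
          rw [f7, f8, f4]
        have A_BA3 : ({((2 * (2 ^ (m₀ + 1)) : ℕ) : ZMod (2 ^ (k + 1))), ((2 * (2 ^ (k - 2) - 2 ^ m₀) : ℕ) : ZMod (2 ^ (k + 1))),
            ((2 * (3 * 2 ^ (k - 2) - 2 ^ m₀) : ℕ) : ZMod (2 ^ (k + 1)))} : Multiset (ZMod (2 ^ (k + 1)))) =
            {((2 ^ (m₀ + 1 + 1) : ℕ) : ZMod (2 ^ (k + 1))), ((2 ^ (k + 1 - 2) - 2 ^ (m₀ + 1) : ℕ) : ZMod (2 ^ (k + 1))),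
            ((3 * 2 ^ (k + 1 - 2) - 2 ^ (m₀ + 1) : ℕ) : ZMod (2 ^ (k + 1)))} := by
          rw [f8, f10, f11]
        rcases hK with (⟨hA, hB⟩ | ⟨hA, hB⟩) | (⟨hA, hB⟩ | ⟨hA, hB⟩) | (⟨hA, hB⟩ | ⟨hA, hB⟩) | (⟨hA, hB⟩ | ⟨hA, hB⟩) |
          (⟨hA, hB⟩ | ⟨hA, hB⟩) | (⟨hA, hB⟩ | ⟨hA, hB⟩) | (⟨hA, hB⟩ | ⟨hA, hB⟩)
        · exact Or.inl (Or.inl ⟨(L er es et hA).trans A_AD, (L er' es' et' hB).trans A_BD⟩)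
        · exact Or.inl (Or.inr ⟨(L er es et hA).trans A_BD, (L er' es' et' hB).trans A_AD⟩)
        · exact Or.inr (Or.inl (Or.inl ⟨(L er es et hA).trans A_AE, (L er' es' et' hB).trans A_BE1⟩))
        · exact Or.inr (Or.inl (Or.inr ⟨(L er es et hA).trans A_BE1, (L er' es' et' hB).trans A_AE⟩))
        · exact Or.inr (Or.inr (Or.inl (Or.inl ⟨(L er es et hA).trans A_AE, (L er' es' et' hB).trans A_BE2⟩)))
        · exact Or.inr (Or.inr (Or.inl (Or.inr ⟨(L er es et hA).trans A_BE2, (L er' es' et' hB).trans A_AE⟩)))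
        · exact Or.inr (Or.inr (Or.inr (Or.inl (Or.inl ⟨(L er es et hA).trans A_AA, (L er' es' et' hB).trans A_BA1⟩))))
        · exact Or.inr (Or.inr (Or.inr (Or.inl (Or.inr ⟨(L er es et hA).trans A_BA1, (L er' es' et' hB).trans A_AA⟩))))
        · exact Or.inr (Or.inr (Or.inr (Or.inr (Or.inl (Or.inl ⟨(L er es et hA).trans A_AA, (L er' es' et' hB).trans A_BA3⟩)))))
        · exact Or.inr (Or.inr (Or.inr (Or.inr (Or.inl (Or.inr ⟨(L er es et hA).trans A_BA3, (L er' es' et' hB).trans A_AA⟩)))))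
        · exact Or.inr (Or.inr (Or.inr (Or.inr (Or.inr (Or.inl (Or.inl ⟨(L er es et hA).trans A_AA, (L er' es' et' hB).trans A_BA2⟩))))))
        · exact Or.inr (Or.inr (Or.inr (Or.inr (Or.inr (Or.inl (Or.inr ⟨(L er es et hA).trans A_BA2, (L er' es' et' hB).trans A_AA⟩))))))
        · exact Or.inr (Or.inr (Or.inr (Or.inr (Or.inr (Or.inr (Or.inl ⟨(L er es et hA).trans A_BA3, (L er' es' et' hB).trans A_BA1⟩))))))
        · exact Or.inr (Or.inr (Or.inr (Or.inr (Or.inr (Or.inr (Or.inr ⟨(L er es et hA).trans A_BA1, (L er' es' et' hB).trans A_BA3⟩))))))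

/-- **KOBLITZ–ROHRLICH THEOREM 4 VERBATIM — every `n`, all pairs of triples, in the one type `ℤ/2ⁿ`.**  "THEOREM 4. Suppose `N = 2ⁿ`.
Then the only isogenies apart from the obvious ones are between pairs of lattices corresponding to the triples a) `(2ᵐ, 2ⁿ⁻¹ − 2ᵐ⁺¹,
2ⁿ⁻¹ + 2ᵐ)` and `(2ᵐ⁺¹, 2ⁿ⁻² − 2ᵐ, 3(2ⁿ⁻²) − 2ᵐ)` for `0 ≤ m ≤ n − 3`, … c) `(2ᵐ, 2ᵐ, 2ⁿ − 2ᵐ⁺¹)` and `(2ᵐ⁺¹, 2ⁿ⁻¹ − 2ᵐ, 2ⁿ⁻¹ − 2ᵐ)`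
for `0 ≤ m ≤ n − 2`, or d) `(2ᵐ, 3(2ᵐ), 2ⁿ − 2ᵐ⁺²)` and `(2ⁿ⁻¹ − 2ᵐ, 2ⁿ⁻¹ − 2ᵐ⁺¹, 3(2ᵐ))` for `0 ≤ m ≤ n − 4`, or e) `(2ᵐ, 2ⁿ⁻¹, 2ⁿ⁻¹ − 2ᵐ)`
and `(2ᵐ, 2ᵐ, 2ⁿ − 2ᵐ⁺¹)` for `0 ≤ m ≤ n − 2`.  Furthermore, a lattice of type a)ₘ is isogenous to the product of two lattices of type
e)ₘ₊₁."; §1 (p. 1185): "`{r, s, t} ~ {r′, s′, t′}` if and only if there exists `h ∈ (ℤ/Nℤ)*` such that, up to a permutation, we have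
`{r′, s′, t′} = {⟨hr⟩, ⟨hs⟩, ⟨ht⟩}` … The equality of lattices `L_{r,s,t}` resulting from an equivalence of triples will be called an
obvious equality, or obvious isogeny."  Tree form: for ANY triples `τ = (r,s,t)`, `τ′ = (r′,s′,t′)` of non-zero residues modulo `2ⁿ`
(`n ≥ 1`) with `r + s + t = 0 = r′ + s′ + t′`, if `H_{τ′} = H_τ` then EITHER `{τ′} = {uτ}` for a unit `u` (an obvious equivalence) OR there
are `m` with `m + 3 ≤ n` and a unit `w` such that `(wτ, wτ′)` is, up to order inside each triple and up to exchange, one of the seven pairs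
d)ₘ `((2ⁿ − 2ᵐ⁺², 2ᵐ, 3(2ᵐ)), (2ⁿ⁻¹ − 2ᵐ⁺¹, 2ⁿ⁻¹ − 2ᵐ, 3(2ᵐ)))`, e)ₘ `((2ⁿ − 2ᵐ⁺¹, 2ᵐ, 2ᵐ), (2ⁿ⁻¹, 2ᵐ, 2ⁿ⁻¹ − 2ᵐ))`, c)ₘ
`((2ⁿ − 2ᵐ⁺¹, 2ᵐ, 2ᵐ), (2ᵐ⁺¹, 2ⁿ⁻¹ − 2ᵐ, 2ⁿ⁻¹ − 2ᵐ))`, `((2ⁿ⁻¹ − 2ᵐ⁺¹, 2ᵐ, 2ⁿ⁻¹ + 2ᵐ), (2ⁿ − 2ᵐ⁺², 2ᵐ⁺¹, 2ᵐ⁺¹))` (a)ₘ with e)ₘ₊₁: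
"Furthermore"), a)ₘ `((2ⁿ⁻¹ − 2ᵐ⁺¹, 2ᵐ, 2ⁿ⁻¹ + 2ᵐ), (2ᵐ⁺¹, 2ⁿ⁻² − 2ᵐ, 3(2ⁿ⁻²) − 2ᵐ))`, `((2ⁿ⁻¹ − 2ᵐ⁺¹, 2ᵐ, 2ⁿ⁻¹ + 2ᵐ),
(2ⁿ⁻¹, 2ᵐ⁺¹, 2ⁿ⁻¹ − 2ᵐ⁺¹))` and `((2ᵐ⁺¹, 2ⁿ⁻² − 2ᵐ, 3(2ⁿ⁻²) − 2ᵐ), (2ⁿ − 2ᵐ⁺², 2ᵐ⁺¹, 2ᵐ⁺¹))` (a)ₘ with e)ₘ₊₁) — induction on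
`n`: a unit among the six ⟹ the sibling's §5 Proposition (`perm_or_exceptional_of_fermatCMType_eq_twoPow`, `n ≥ 4`; at `N = 8` the sibling's
kernel-enumerated list, at `N = 4` everything is obvious, at `N = 2` there is no admissible triple); otherwise all six entries are even, the
coincidence descends to level `2ⁿ⁻¹` (sibling `fermatCMType_eq_of_fermatCMType_level_mul_eq`, "`N/M = g.c.d.(N, r, s)`") and the answer
lifts with `m ↦ m + 1` (sibling `exists_unit_multiset_mul_eq_succ`).  The `2`-content of the triples is found by the induction; no g.c.d.
is prescribed. [cite: KoblitzRohrlich1978, Theorem 4 (p. 1186), §5 Proposition (p. 1200), §1 (pp. 1183–1185)] -/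
theorem obvious_or_exceptional_of_fermatCMType_eq_twoPow_all {n : ℕ} (hn : n ≠ 0) {r s t r' s' t' : ZMod (2 ^ n)}
    (hr0 : r ≠ 0) (hs0 : s ≠ 0) (ht0 : t ≠ 0) (hrst : r + s + t = 0)
    (hr'0 : r' ≠ 0) (hs'0 : s' ≠ 0) (ht'0 : t' ≠ 0) (hrst' : r' + s' + t' = 0)
    (heq : fermatCMType (2 ^ n) r' s' t' = fermatCMType (2 ^ n) r s t) :
    (∃ u : ZMod (2 ^ n), IsUnit u ∧ ({r', s', t'} : Multiset (ZMod (2 ^ n))) = {u * r, u * s, u * t}) ∨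
      ∃ m : ℕ, m + 3 ≤ n ∧ ∃ w : ZMod (2 ^ n), IsUnit w ∧
        (((({w * r, w * s, w * t} : Multiset (ZMod (2 ^ n))) =
            {((2 ^ n - 2 ^ (m + 2) : ℕ) : ZMod (2 ^ n)), ((2 ^ m : ℕ) : ZMod (2 ^ n)),
              ((3 * 2 ^ m : ℕ) : ZMod (2 ^ n))} ∧
          ({w * r', w * s', w * t'} : Multiset (ZMod (2 ^ n))) =
            {((2 ^ (n - 1) - 2 ^ (m + 1) : ℕ) : ZMod (2 ^ n)), ((2 ^ (n - 1) - 2 ^ m : ℕ) : ZMod (2 ^ n)),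
              ((3 * 2 ^ m : ℕ) : ZMod (2 ^ n))}) ∨
          (({w * r, w * s, w * t} : Multiset (ZMod (2 ^ n))) =
            {((2 ^ (n - 1) - 2 ^ (m + 1) : ℕ) : ZMod (2 ^ n)), ((2 ^ (n - 1) - 2 ^ m : ℕ) : ZMod (2 ^ n)),
              ((3 * 2 ^ m : ℕ) : ZMod (2 ^ n))} ∧
          ({w * r', w * s', w * t'} : Multiset (ZMod (2 ^ n))) =
            {((2 ^ n - 2 ^ (m + 2) : ℕ) : ZMod (2 ^ n)), ((2 ^ m : ℕ) : ZMod (2 ^ n)),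
              ((3 * 2 ^ m : ℕ) : ZMod (2 ^ n))})) ∨
        ((({w * r, w * s, w * t} : Multiset (ZMod (2 ^ n))) =
            {((2 ^ n - 2 ^ (m + 1) : ℕ) : ZMod (2 ^ n)), ((2 ^ m : ℕ) : ZMod (2 ^ n)),
              ((2 ^ m : ℕ) : ZMod (2 ^ n))} ∧
          ({w * r', w * s', w * t'} : Multiset (ZMod (2 ^ n))) =
            {((2 ^ (n - 1) : ℕ) : ZMod (2 ^ n)), ((2 ^ m : ℕ) : ZMod (2 ^ n)),
              ((2 ^ (n - 1) - 2 ^ m : ℕ) : ZMod (2 ^ n))}) ∨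
          (({w * r, w * s, w * t} : Multiset (ZMod (2 ^ n))) =
            {((2 ^ (n - 1) : ℕ) : ZMod (2 ^ n)), ((2 ^ m : ℕ) : ZMod (2 ^ n)),
              ((2 ^ (n - 1) - 2 ^ m : ℕ) : ZMod (2 ^ n))} ∧
          ({w * r', w * s', w * t'} : Multiset (ZMod (2 ^ n))) =
            {((2 ^ n - 2 ^ (m + 1) : ℕ) : ZMod (2 ^ n)), ((2 ^ m : ℕ) : ZMod (2 ^ n)),
              ((2 ^ m : ℕ) : ZMod (2 ^ n))})) ∨
        ((({w * r, w * s, w * t} : Multiset (ZMod (2 ^ n))) =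
            {((2 ^ n - 2 ^ (m + 1) : ℕ) : ZMod (2 ^ n)), ((2 ^ m : ℕ) : ZMod (2 ^ n)),
              ((2 ^ m : ℕ) : ZMod (2 ^ n))} ∧
          ({w * r', w * s', w * t'} : Multiset (ZMod (2 ^ n))) =
            {((2 ^ (m + 1) : ℕ) : ZMod (2 ^ n)), ((2 ^ (n - 1) - 2 ^ m : ℕ) : ZMod (2 ^ n)),
              ((2 ^ (n - 1) - 2 ^ m : ℕ) : ZMod (2 ^ n))}) ∨
          (({w * r, w * s, w * t} : Multiset (ZMod (2 ^ n))) =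
            {((2 ^ (m + 1) : ℕ) : ZMod (2 ^ n)), ((2 ^ (n - 1) - 2 ^ m : ℕ) : ZMod (2 ^ n)),
              ((2 ^ (n - 1) - 2 ^ m : ℕ) : ZMod (2 ^ n))} ∧
          ({w * r', w * s', w * t'} : Multiset (ZMod (2 ^ n))) =
            {((2 ^ n - 2 ^ (m + 1) : ℕ) : ZMod (2 ^ n)), ((2 ^ m : ℕ) : ZMod (2 ^ n)),
              ((2 ^ m : ℕ) : ZMod (2 ^ n))})) ∨
        ((({w * r, w * s, w * t} : Multiset (ZMod (2 ^ n))) =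
            {((2 ^ (n - 1) - 2 ^ (m + 1) : ℕ) : ZMod (2 ^ n)), ((2 ^ m : ℕ) : ZMod (2 ^ n)),
              ((2 ^ (n - 1) + 2 ^ m : ℕ) : ZMod (2 ^ n))} ∧
          ({w * r', w * s', w * t'} : Multiset (ZMod (2 ^ n))) =
            {((2 ^ n - 2 ^ (m + 2) : ℕ) : ZMod (2 ^ n)), ((2 ^ (m + 1) : ℕ) : ZMod (2 ^ n)),
              ((2 ^ (m + 1) : ℕ) : ZMod (2 ^ n))}) ∨
          (({w * r, w * s, w * t} : Multiset (ZMod (2 ^ n))) =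
            {((2 ^ n - 2 ^ (m + 2) : ℕ) : ZMod (2 ^ n)), ((2 ^ (m + 1) : ℕ) : ZMod (2 ^ n)),
              ((2 ^ (m + 1) : ℕ) : ZMod (2 ^ n))} ∧
          ({w * r', w * s', w * t'} : Multiset (ZMod (2 ^ n))) =
            {((2 ^ (n - 1) - 2 ^ (m + 1) : ℕ) : ZMod (2 ^ n)), ((2 ^ m : ℕ) : ZMod (2 ^ n)),
              ((2 ^ (n - 1) + 2 ^ m : ℕ) : ZMod (2 ^ n))})) ∨
        ((({w * r, w * s, w * t} : Multiset (ZMod (2 ^ n))) =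
            {((2 ^ (n - 1) - 2 ^ (m + 1) : ℕ) : ZMod (2 ^ n)), ((2 ^ m : ℕ) : ZMod (2 ^ n)),
              ((2 ^ (n - 1) + 2 ^ m : ℕ) : ZMod (2 ^ n))} ∧
          ({w * r', w * s', w * t'} : Multiset (ZMod (2 ^ n))) =
            {((2 ^ (m + 1) : ℕ) : ZMod (2 ^ n)), ((2 ^ (n - 2) - 2 ^ m : ℕ) : ZMod (2 ^ n)),
              ((3 * 2 ^ (n - 2) - 2 ^ m : ℕ) : ZMod (2 ^ n))}) ∨
          (({w * r, w * s, w * t} : Multiset (ZMod (2 ^ n))) =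
            {((2 ^ (m + 1) : ℕ) : ZMod (2 ^ n)), ((2 ^ (n - 2) - 2 ^ m : ℕ) : ZMod (2 ^ n)),
              ((3 * 2 ^ (n - 2) - 2 ^ m : ℕ) : ZMod (2 ^ n))} ∧
          ({w * r', w * s', w * t'} : Multiset (ZMod (2 ^ n))) =
            {((2 ^ (n - 1) - 2 ^ (m + 1) : ℕ) : ZMod (2 ^ n)), ((2 ^ m : ℕ) : ZMod (2 ^ n)),
              ((2 ^ (n - 1) + 2 ^ m : ℕ) : ZMod (2 ^ n))})) ∨
        ((({w * r, w * s, w * t} : Multiset (ZMod (2 ^ n))) =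
            {((2 ^ (n - 1) - 2 ^ (m + 1) : ℕ) : ZMod (2 ^ n)), ((2 ^ m : ℕ) : ZMod (2 ^ n)),
              ((2 ^ (n - 1) + 2 ^ m : ℕ) : ZMod (2 ^ n))} ∧
          ({w * r', w * s', w * t'} : Multiset (ZMod (2 ^ n))) =
            {((2 ^ (n - 1) : ℕ) : ZMod (2 ^ n)), ((2 ^ (m + 1) : ℕ) : ZMod (2 ^ n)),
              ((2 ^ (n - 1) - 2 ^ (m + 1) : ℕ) : ZMod (2 ^ n))}) ∨
          (({w * r, w * s, w * t} : Multiset (ZMod (2 ^ n))) =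
            {((2 ^ (n - 1) : ℕ) : ZMod (2 ^ n)), ((2 ^ (m + 1) : ℕ) : ZMod (2 ^ n)),
              ((2 ^ (n - 1) - 2 ^ (m + 1) : ℕ) : ZMod (2 ^ n))} ∧
          ({w * r', w * s', w * t'} : Multiset (ZMod (2 ^ n))) =
            {((2 ^ (n - 1) - 2 ^ (m + 1) : ℕ) : ZMod (2 ^ n)), ((2 ^ m : ℕ) : ZMod (2 ^ n)),
              ((2 ^ (n - 1) + 2 ^ m : ℕ) : ZMod (2 ^ n))})) ∨
        ((({w * r, w * s, w * t} : Multiset (ZMod (2 ^ n))) =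
            {((2 ^ (m + 1) : ℕ) : ZMod (2 ^ n)), ((2 ^ (n - 2) - 2 ^ m : ℕ) : ZMod (2 ^ n)),
              ((3 * 2 ^ (n - 2) - 2 ^ m : ℕ) : ZMod (2 ^ n))} ∧
          ({w * r', w * s', w * t'} : Multiset (ZMod (2 ^ n))) =
            {((2 ^ n - 2 ^ (m + 2) : ℕ) : ZMod (2 ^ n)), ((2 ^ (m + 1) : ℕ) : ZMod (2 ^ n)),
              ((2 ^ (m + 1) : ℕ) : ZMod (2 ^ n))}) ∨
          (({w * r, w * s, w * t} : Multiset (ZMod (2 ^ n))) =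
            {((2 ^ n - 2 ^ (m + 2) : ℕ) : ZMod (2 ^ n)), ((2 ^ (m + 1) : ℕ) : ZMod (2 ^ n)),
              ((2 ^ (m + 1) : ℕ) : ZMod (2 ^ n))} ∧
          ({w * r', w * s', w * t'} : Multiset (ZMod (2 ^ n))) =
            {((2 ^ (m + 1) : ℕ) : ZMod (2 ^ n)), ((2 ^ (n - 2) - 2 ^ m : ℕ) : ZMod (2 ^ n)),
              ((3 * 2 ^ (n - 2) - 2 ^ m : ℕ) : ZMod (2 ^ n))}))) :=
  twoPow_all_aux n hn r s t r' s' t' hr0 hs0 ht0 hrst hr'0 hs'0 ht'0 hrst' heq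

end AllTriples

/-! ## §4 THEOREM 4 ON ABELIAN VARIETIES — every `n`, all pairs of admissible triples -/

section AllTriplesVarieties

open CategoryTheory
open Literature.AlgebraicGeometry.Motives (AbelianVariety)
open Literature.AlgebraicGeometry.HodgeTheory
open CyclotomicCMTypeResidueSets (unitResidues IsCMResidueSet)

variable {n : ℕ} {L : Type} [Field L] [NumberField L] [IsCyclotomicExtension {2 ^ n} ℚ L]
  {A A' : AbelianVariety ℂ} {ι : 𝓞 L →+* End A} {θ : L →+* Module.End ℂ (complexBetti A.X 1)}
  {ι' : 𝓞 L →+* End A'} {θ' : L →+* Module.End ℂ (complexBetti A'.X 1)}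

/-- **KOBLITZ–ROHRLICH THEOREM 4 ON ABELIAN VARIETIES, every `n`, ALL PAIRS OF ADMISSIBLE TRIPLES** (`N = 2ⁿ`, `n ≥ 1`): for ANY triples
`τ = (r,s,t)`, `τ′ = (r′,s′,t′)` of non-zero residues modulo `2ⁿ` with `r + s + t = 0 = r′ + s′ + t′`, abelian varieties `A`, `A′` of types
`Φ_{H_τ}`, `Φ_{H_{τ′}}` of `ℚ(ζ_{2ⁿ})` are ISOGENOUS iff EITHER `{r′,s′,t′} = {ur, us, ut}` for a unit `u` ("the obvious ones") OR for some `m`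
with `m + 3 ≤ n` and units `w, w′` the pair `(wτ, w′τ′)` is one of Theorem 4's seven pairs of `2`-content `2ᵐ` (d)ₘ, e)ₘ, c)ₘ, a)ₘ and
the three a)ₘ–e)ₘ₊₁ pairs, as in `obvious_or_exceptional_of_fermatCMType_eq_twoPow_all`) up to order inside each triple, or the same with
the two triples exchanged — "the only isogenies apart from the obvious ones are between pairs of lattices corresponding to the triples a) …
e) … Furthermore …" (Shimura–Taniyama `A_τ ∼ A_{τ′} ⟺ H_{τ′} = H_{uτ}`, sibling `isIsogenous_fermatCMType_iff_exists_eq_mul`, composed with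
§3; "⟸" by §2's seven equalities).
[cite: KoblitzRohrlich1978, Theorem 4 (p. 1186), §5 Proposition (p. 1200), §1 (pp. 1184–1185)] [cite: Shimura1998, §8.4 Example (1) and §6.1 Corollary] -/
theorem isIsogenous_iff_obvious_or_exceptional_twoPow_all [IsCMField L] (hn : n ≠ 0) {r s t r' s' t' : ZMod (2 ^ n)}
    (hr0 : r ≠ 0) (hs0 : s ≠ 0) (ht0 : t ≠ 0) (hrst : r + s + t = 0)
    (hr'0 : r' ≠ 0) (hs'0 : s' ≠ 0) (ht'0 : t' ≠ 0) (hrst' : r' + s' + t' = 0)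
    (hS : IsCMResidueSet (2 ^ n) (fermatCMType (2 ^ n) r s t))
    (hS' : IsCMResidueSet (2 ^ n) (fermatCMType (2 ^ n) r' s' t'))
    (hA : IsCMTypeRealisation (cmTypeOfResidues (L := L) (fermatCMType (2 ^ n) r s t) hS.cm) A ι θ)
    (hA' : IsCMTypeRealisation (cmTypeOfResidues (L := L) (fermatCMType (2 ^ n) r' s' t') hS'.cm) A' ι' θ') :
    AbelianVariety.IsIsogenous A A' ↔
      (∃ u : ZMod (2 ^ n), IsUnit u ∧ ({r', s', t'} : Multiset (ZMod (2 ^ n))) = {u * r, u * s, u * t}) ∨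
        ∃ m : ℕ, m + 3 ≤ n ∧ ∃ w w' : ZMod (2 ^ n), IsUnit w ∧ IsUnit w' ∧
          (((({w * r, w * s, w * t} : Multiset (ZMod (2 ^ n))) =
                {((2 ^ n - 2 ^ (m + 2) : ℕ) : ZMod (2 ^ n)), ((2 ^ m : ℕ) : ZMod (2 ^ n)),
                  ((3 * 2 ^ m : ℕ) : ZMod (2 ^ n))} ∧
              ({w' * r', w' * s', w' * t'} : Multiset (ZMod (2 ^ n))) =
                {((2 ^ (n - 1) - 2 ^ (m + 1) : ℕ) : ZMod (2 ^ n)), ((2 ^ (n - 1) - 2 ^ m : ℕ) : ZMod (2 ^ n)),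
                  ((3 * 2 ^ m : ℕ) : ZMod (2 ^ n))}) ∨
              (({w * r, w * s, w * t} : Multiset (ZMod (2 ^ n))) =
                {((2 ^ (n - 1) - 2 ^ (m + 1) : ℕ) : ZMod (2 ^ n)), ((2 ^ (n - 1) - 2 ^ m : ℕ) : ZMod (2 ^ n)),
                  ((3 * 2 ^ m : ℕ) : ZMod (2 ^ n))} ∧
              ({w' * r', w' * s', w' * t'} : Multiset (ZMod (2 ^ n))) =
                {((2 ^ n - 2 ^ (m + 2) : ℕ) : ZMod (2 ^ n)), ((2 ^ m : ℕ) : ZMod (2 ^ n)),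
                  ((3 * 2 ^ m : ℕ) : ZMod (2 ^ n))})) ∨
            ((({w * r, w * s, w * t} : Multiset (ZMod (2 ^ n))) =
                {((2 ^ n - 2 ^ (m + 1) : ℕ) : ZMod (2 ^ n)), ((2 ^ m : ℕ) : ZMod (2 ^ n)),
                  ((2 ^ m : ℕ) : ZMod (2 ^ n))} ∧
              ({w' * r', w' * s', w' * t'} : Multiset (ZMod (2 ^ n))) =
                {((2 ^ (n - 1) : ℕ) : ZMod (2 ^ n)), ((2 ^ m : ℕ) : ZMod (2 ^ n)),
                  ((2 ^ (n - 1) - 2 ^ m : ℕ) : ZMod (2 ^ n))}) ∨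
              (({w * r, w * s, w * t} : Multiset (ZMod (2 ^ n))) =
                {((2 ^ (n - 1) : ℕ) : ZMod (2 ^ n)), ((2 ^ m : ℕ) : ZMod (2 ^ n)),
                  ((2 ^ (n - 1) - 2 ^ m : ℕ) : ZMod (2 ^ n))} ∧
              ({w' * r', w' * s', w' * t'} : Multiset (ZMod (2 ^ n))) =
                {((2 ^ n - 2 ^ (m + 1) : ℕ) : ZMod (2 ^ n)), ((2 ^ m : ℕ) : ZMod (2 ^ n)),
                  ((2 ^ m : ℕ) : ZMod (2 ^ n))})) ∨
            ((({w * r, w * s, w * t} : Multiset (ZMod (2 ^ n))) =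
                {((2 ^ n - 2 ^ (m + 1) : ℕ) : ZMod (2 ^ n)), ((2 ^ m : ℕ) : ZMod (2 ^ n)),
                  ((2 ^ m : ℕ) : ZMod (2 ^ n))} ∧
              ({w' * r', w' * s', w' * t'} : Multiset (ZMod (2 ^ n))) =
                {((2 ^ (m + 1) : ℕ) : ZMod (2 ^ n)), ((2 ^ (n - 1) - 2 ^ m : ℕ) : ZMod (2 ^ n)),
                  ((2 ^ (n - 1) - 2 ^ m : ℕ) : ZMod (2 ^ n))}) ∨
              (({w * r, w * s, w * t} : Multiset (ZMod (2 ^ n))) =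
                {((2 ^ (m + 1) : ℕ) : ZMod (2 ^ n)), ((2 ^ (n - 1) - 2 ^ m : ℕ) : ZMod (2 ^ n)),
                  ((2 ^ (n - 1) - 2 ^ m : ℕ) : ZMod (2 ^ n))} ∧
              ({w' * r', w' * s', w' * t'} : Multiset (ZMod (2 ^ n))) =
                {((2 ^ n - 2 ^ (m + 1) : ℕ) : ZMod (2 ^ n)), ((2 ^ m : ℕ) : ZMod (2 ^ n)),
                  ((2 ^ m : ℕ) : ZMod (2 ^ n))})) ∨
            ((({w * r, w * s, w * t} : Multiset (ZMod (2 ^ n))) =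
                {((2 ^ (n - 1) - 2 ^ (m + 1) : ℕ) : ZMod (2 ^ n)), ((2 ^ m : ℕ) : ZMod (2 ^ n)),
                  ((2 ^ (n - 1) + 2 ^ m : ℕ) : ZMod (2 ^ n))} ∧
              ({w' * r', w' * s', w' * t'} : Multiset (ZMod (2 ^ n))) =
                {((2 ^ n - 2 ^ (m + 2) : ℕ) : ZMod (2 ^ n)), ((2 ^ (m + 1) : ℕ) : ZMod (2 ^ n)),
                  ((2 ^ (m + 1) : ℕ) : ZMod (2 ^ n))}) ∨
              (({w * r, w * s, w * t} : Multiset (ZMod (2 ^ n))) =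
                {((2 ^ n - 2 ^ (m + 2) : ℕ) : ZMod (2 ^ n)), ((2 ^ (m + 1) : ℕ) : ZMod (2 ^ n)),
                  ((2 ^ (m + 1) : ℕ) : ZMod (2 ^ n))} ∧
              ({w' * r', w' * s', w' * t'} : Multiset (ZMod (2 ^ n))) =
                {((2 ^ (n - 1) - 2 ^ (m + 1) : ℕ) : ZMod (2 ^ n)), ((2 ^ m : ℕ) : ZMod (2 ^ n)),
                  ((2 ^ (n - 1) + 2 ^ m : ℕ) : ZMod (2 ^ n))})) ∨
            ((({w * r, w * s, w * t} : Multiset (ZMod (2 ^ n))) =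
                {((2 ^ (n - 1) - 2 ^ (m + 1) : ℕ) : ZMod (2 ^ n)), ((2 ^ m : ℕ) : ZMod (2 ^ n)),
                  ((2 ^ (n - 1) + 2 ^ m : ℕ) : ZMod (2 ^ n))} ∧
              ({w' * r', w' * s', w' * t'} : Multiset (ZMod (2 ^ n))) =
                {((2 ^ (m + 1) : ℕ) : ZMod (2 ^ n)), ((2 ^ (n - 2) - 2 ^ m : ℕ) : ZMod (2 ^ n)),
                  ((3 * 2 ^ (n - 2) - 2 ^ m : ℕ) : ZMod (2 ^ n))}) ∨
              (({w * r, w * s, w * t} : Multiset (ZMod (2 ^ n))) =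
                {((2 ^ (m + 1) : ℕ) : ZMod (2 ^ n)), ((2 ^ (n - 2) - 2 ^ m : ℕ) : ZMod (2 ^ n)),
                  ((3 * 2 ^ (n - 2) - 2 ^ m : ℕ) : ZMod (2 ^ n))} ∧
              ({w' * r', w' * s', w' * t'} : Multiset (ZMod (2 ^ n))) =
                {((2 ^ (n - 1) - 2 ^ (m + 1) : ℕ) : ZMod (2 ^ n)), ((2 ^ m : ℕ) : ZMod (2 ^ n)),
                  ((2 ^ (n - 1) + 2 ^ m : ℕ) : ZMod (2 ^ n))})) ∨
            ((({w * r, w * s, w * t} : Multiset (ZMod (2 ^ n))) =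
                {((2 ^ (n - 1) - 2 ^ (m + 1) : ℕ) : ZMod (2 ^ n)), ((2 ^ m : ℕ) : ZMod (2 ^ n)),
                  ((2 ^ (n - 1) + 2 ^ m : ℕ) : ZMod (2 ^ n))} ∧
              ({w' * r', w' * s', w' * t'} : Multiset (ZMod (2 ^ n))) =
                {((2 ^ (n - 1) : ℕ) : ZMod (2 ^ n)), ((2 ^ (m + 1) : ℕ) : ZMod (2 ^ n)),
                  ((2 ^ (n - 1) - 2 ^ (m + 1) : ℕ) : ZMod (2 ^ n))}) ∨
              (({w * r, w * s, w * t} : Multiset (ZMod (2 ^ n))) =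
                {((2 ^ (n - 1) : ℕ) : ZMod (2 ^ n)), ((2 ^ (m + 1) : ℕ) : ZMod (2 ^ n)),
                  ((2 ^ (n - 1) - 2 ^ (m + 1) : ℕ) : ZMod (2 ^ n))} ∧
              ({w' * r', w' * s', w' * t'} : Multiset (ZMod (2 ^ n))) =
                {((2 ^ (n - 1) - 2 ^ (m + 1) : ℕ) : ZMod (2 ^ n)), ((2 ^ m : ℕ) : ZMod (2 ^ n)),
                  ((2 ^ (n - 1) + 2 ^ m : ℕ) : ZMod (2 ^ n))})) ∨
            ((({w * r, w * s, w * t} : Multiset (ZMod (2 ^ n))) =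
                {((2 ^ (m + 1) : ℕ) : ZMod (2 ^ n)), ((2 ^ (n - 2) - 2 ^ m : ℕ) : ZMod (2 ^ n)),
                  ((3 * 2 ^ (n - 2) - 2 ^ m : ℕ) : ZMod (2 ^ n))} ∧
              ({w' * r', w' * s', w' * t'} : Multiset (ZMod (2 ^ n))) =
                {((2 ^ n - 2 ^ (m + 2) : ℕ) : ZMod (2 ^ n)), ((2 ^ (m + 1) : ℕ) : ZMod (2 ^ n)),
                  ((2 ^ (m + 1) : ℕ) : ZMod (2 ^ n))}) ∨
              (({w * r, w * s, w * t} : Multiset (ZMod (2 ^ n))) =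
                {((2 ^ n - 2 ^ (m + 2) : ℕ) : ZMod (2 ^ n)), ((2 ^ (m + 1) : ℕ) : ZMod (2 ^ n)),
                  ((2 ^ (m + 1) : ℕ) : ZMod (2 ^ n))} ∧
              ({w' * r', w' * s', w' * t'} : Multiset (ZMod (2 ^ n))) =
                {((2 ^ (m + 1) : ℕ) : ZMod (2 ^ n)), ((2 ^ (n - 2) - 2 ^ m : ℕ) : ZMod (2 ^ n)),
                  ((3 * 2 ^ (n - 2) - 2 ^ m : ℕ) : ZMod (2 ^ n))}))) := by
  rw [isIsogenous_fermatCMType_iff_exists_eq_mul hS hS' hA hA']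
  constructor
  · rintro ⟨u, hu, heq⟩
    have h1 : u * r ≠ 0 := fun h => hr0 (hu.mul_right_eq_zero.mp h)
    have h2 : u * s ≠ 0 := fun h => hs0 (hu.mul_right_eq_zero.mp h)
    have h3 : u * t ≠ 0 := fun h => ht0 (hu.mul_right_eq_zero.mp h)
    have h4 : u * r + u * s + u * t = 0 := by rw [← mul_add, ← mul_add, hrst, mul_zero]
    rcases obvious_or_exceptional_of_fermatCMType_eq_twoPow_all hn h1 h2 h3 h4 hr'0 hs'0 ht'0 hrst' heq with
      ⟨u₂, hu₂, hperm⟩ | ⟨m, hm, w, hw, h⟩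
    · refine Or.inl ⟨u₂ * u, hu₂.mul hu, ?_⟩
      simpa only [mul_assoc] using hperm
    · refine Or.inr ⟨m, hm, w * u, w, hw.mul hu, hw, ?_⟩
      simpa only [mul_assoc] using h
  · rintro (⟨u, hu, hperm⟩ | ⟨m, hm, w, w', hw, hw', h⟩)
    · exact ⟨u, hu, fermatCMType_eq_of_multiset_eq hperm⟩
    · obtain ⟨Q₁, Q₂, Q₃, Q₄, Q₅, Q₆, Q₇⟩ := fermatCMType_twoPow_pairs_eq hm
      obtain ⟨wi, hwi⟩ := hw'.exists_right_inv
      have hwi' : IsUnit wi := IsUnit.of_mul_eq_one_right w' hwi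
      refine ⟨wi * w, hwi'.mul hw, ?_⟩
      have e : ∀ z : ZMod (2 ^ n), w' * (wi * w * z) = w * z := fun z => by
        rw [← mul_assoc, ← mul_assoc, hwi, one_mul]
      apply (fermatCMType_mul_eq_mul_iff hw').1
      rw [e, e, e]
      rcases h with (⟨hτ, hτ'⟩ | ⟨hτ, hτ'⟩) | (⟨hτ, hτ'⟩ | ⟨hτ, hτ'⟩) | (⟨hτ, hτ'⟩ | ⟨hτ, hτ'⟩) | (⟨hτ, hτ'⟩ | ⟨hτ, hτ'⟩) |
        (⟨hτ, hτ'⟩ | ⟨hτ, hτ'⟩) | (⟨hτ, hτ'⟩ | ⟨hτ, hτ'⟩) | (⟨hτ, hτ'⟩ | ⟨hτ, hτ'⟩)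
      · exact (fermatCMType_eq_of_multiset_eq hτ').trans ((Q₁).trans (fermatCMType_eq_of_multiset_eq hτ).symm)
      · exact (fermatCMType_eq_of_multiset_eq hτ').trans ((Q₁).symm.trans (fermatCMType_eq_of_multiset_eq hτ).symm)
      · exact (fermatCMType_eq_of_multiset_eq hτ').trans ((Q₂).trans (fermatCMType_eq_of_multiset_eq hτ).symm)
      · exact (fermatCMType_eq_of_multiset_eq hτ').trans ((Q₂).symm.trans (fermatCMType_eq_of_multiset_eq hτ).symm)
      · exact (fermatCMType_eq_of_multiset_eq hτ').trans ((Q₃).trans (fermatCMType_eq_of_multiset_eq hτ).symm)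
      · exact (fermatCMType_eq_of_multiset_eq hτ').trans ((Q₃).symm.trans (fermatCMType_eq_of_multiset_eq hτ).symm)
      · exact (fermatCMType_eq_of_multiset_eq hτ').trans ((Q₄).trans (fermatCMType_eq_of_multiset_eq hτ).symm)
      · exact (fermatCMType_eq_of_multiset_eq hτ').trans ((Q₄).symm.trans (fermatCMType_eq_of_multiset_eq hτ).symm)
      · exact (fermatCMType_eq_of_multiset_eq hτ').trans ((Q₅).trans (fermatCMType_eq_of_multiset_eq hτ).symm)
      · exact (fermatCMType_eq_of_multiset_eq hτ').trans ((Q₅).symm.trans (fermatCMType_eq_of_multiset_eq hτ).symm)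
      · exact (fermatCMType_eq_of_multiset_eq hτ').trans ((Q₆).trans (fermatCMType_eq_of_multiset_eq hτ).symm)
      · exact (fermatCMType_eq_of_multiset_eq hτ').trans ((Q₆).symm.trans (fermatCMType_eq_of_multiset_eq hτ).symm)
      · exact (fermatCMType_eq_of_multiset_eq hτ').trans ((Q₇).trans (fermatCMType_eq_of_multiset_eq hτ).symm)
      · exact (fermatCMType_eq_of_multiset_eq hτ').trans ((Q₇).symm.trans (fermatCMType_eq_of_multiset_eq hτ).symm)

end AllTriplesVarieties

end CyclotomicFermatCMType

end Literature.AlgebraicGeometry.ComplexMultiplication
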